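import Literature.NumberTheory.EllipticCurves.Shintani32Level128Law
import Literature.NumberTheory.EllipticCurves.ShintaniLiftUnfolded
import HarnessLib

/-!
# The level-`32` Shintani lift: definition, automorphy, unfolding, and the vanishing of the null and definite orbits

[[cite: Shintani1975, §2 (2.1), (2.8)–(2.14), Prop. 2.1, proof of Prop. 2.3, Thm. 2]] — the `N = 32`
twin of the tree's `ShintaniLift`, `ShintaniLatticeAction`, `ShintaniLiftTermwise`,
`ShintaniOrbitUnfolding`, `ShintaniNullStabilizers`, `ShintaniNullOrbits`, `ShintaniDefiniteOrbits`
and `ShintaniLiftUnfolded` (`N = 64`), for `φ ∈ S₂(Γ₀(32))` (the congruent-number newform's level)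
against the kernel `K₃₂,D` of `Shintani32Kernel` on `L♮₃₂ = {[32a, b, c]}` (`D` odd square-free;
weight `-2` in `w` under `Γ₀(32)`, `θ`-automorphic of weight `3/2` on `Γ₀(128)` with TRIVIAL
character in `z`, `Shintani32Level128Law`).  Three parts, each mirroring the level-`64` file it
twins (the generic lemmas of those files are reused, not restated):

1. **The lift** `Φ₃₂,D(z) = ∫_{Γ₀(32)∖ℍ} φ(w) K₃₂,D(w, z) dμ(w)` (`shintaniLift32`):
   `liftIntegrand32_smul`, **`isThetaAutomorphic_shintaniLift32`** (`IsThetaAutomorphic 3 128 1`),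
   `integrableOn_liftIntegrand32` (decay of translates of cusp forms + the uniform theta-sum bound
   moved by `intAct32`), `measurable_kerD32`.
2. **Unfolding**: the action `γ • k = k ∘ γ⁻¹` of `Γ₀(32)⁺` on `ℤ³` (`latMulAction32`, `cq32 = c/32`),
   equivariance `shintaniFn_latSharp32_smul`, termwise integration `shintaniLift32_eq_tsum_integral`,
   the orbit identity `tsum_quotient_integral_liftTerm32_eq`, `liftTerm32_stab_invariant`.
3. **Null and definite orbits vanish**: `trace_ne_neg_two32`, `exists_conj_to_yTwo32`,
   `null_stabilizer32`, `integral_orbitDomain32_eq_zero_of_null` (strip integral of a cusp form),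
   `integral_orbitDomain32_eq_zero_of_disc_neg` (Cayley disc model), and the unfolded lift
   **`shintaniLift32_eq_tsum_orbitIntegral32`**:
   `Φ₃₂,D(z) = √(Im z) ∑_{ω ∈ ℤ³/Γ₀(32)⁺, disc ι♮₃₂(k_ω) > 0} J(ω)`.

No named facts; definitions `intAct32`, `liftIntegrand32`, `reps32`, `liftDomain32`,
`shintaniLift32`, `cq32`, `latSmul32`, `zScaled32`, `liftTerm32`, `stabK32`, `cosetRepInv32`,
`quotEquivCosetRepInv32`, `orbitDomain32`, `jSubgroup32`, `orbitIntegral32` and the instances.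
-/

noncomputable section

open Complex Real MeasureTheory Filter Asymptotics
open scoped MatrixGroups ModularForm Modular Topology Pointwise

namespace Literature.NumberTheory.EllipticCurves.Shintani

open UpperHalfPlane hiding I
open CongruenceSubgroup ModularGroup
open Literature.NumberTheory.EllipticCurves.ModularForms

/-! ### The kernel at a translate: `‖K₃₂,D(aτ; z)‖ ≤ √(Im z) ‖cτ+d‖⁻² C (Im τ)²` -/

section KernelBound

variable (D : ℕ) [NeZero D]

omit [NeZero D] in
/-- `|c_D(k)| ≤ 1`. [folklore] -/
theorem norm_cD32_le_one (k : Fin 3 → ℤ) : ‖cD32 D k‖ ≤ 1 := by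
  unfold cD32
  split_ifs
  · rw [Complex.norm_intCast]
    exact_mod_cast abs_genusWt32_le D _
  · simp

/-- The integer matrix action on `ℤ³` whose image under `vec` is `actV a (ι♮₃₂ k)`. [folklore] -/
def intAct32 (a : SL(2, ℤ)) (k : Fin 3 → ℤ) : Fin 3 → ℤ :=
  ![32 * k 0 * (a 0 0) ^ 2 + k 1 * (a 0 0) * (a 1 0) + k 2 * (a 1 0) ^ 2,
    2 * (32 * k 0) * (a 0 0) * (a 0 1) + k 1 * (a 0 0 * a 1 1 + a 0 1 * a 1 0) + 2 * k 2 * (a 1 0) * (a 1 1),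
    32 * k 0 * (a 0 1) ^ 2 + k 1 * (a 0 1) * (a 1 1) + k 2 * (a 1 1) ^ 2]

/-- `vec (intAct32 a k) = actV a (ι♮₃₂ k)`. [folklore] -/
theorem vec_intAct32 (a : SL(2, ℤ)) (k : Fin 3 → ℤ) :
    vec (intAct32 a k) = actV (a 0 0 : ℤ) (a 0 1 : ℤ) (a 1 0 : ℤ) (a 1 1 : ℤ) (latSharp32 k) := by
  ext i
  fin_cases i <;> simp [vec, intAct32, actV, latSharp32]

/-- `intAct32 a` is injective. [folklore] -/
theorem intAct32_injective (a : SL(2, ℤ)) : Function.Injective (intAct32 a) := by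
  intro k l h
  have hv : actV (a 0 0 : ℤ) (a 0 1 : ℤ) (a 1 0 : ℤ) (a 1 1 : ℤ) (latSharp32 k) =
      actV (a 0 0 : ℤ) (a 0 1 : ℤ) (a 1 0 : ℤ) (a 1 1 : ℤ) (latSharp32 l) := by
    rw [← vec_intAct32, ← vec_intAct32, h]
  have hdet : ((a 0 0 : ℤ) : ℝ) * (a 1 1 : ℤ) - (a 0 1 : ℤ) * (a 1 0 : ℤ) = 1 := by
    exact_mod_cast Literature.NumberTheory.EllipticCurves.ModularForms.det_eq_one' a
  have hinv : ∀ x : V, actV (a 1 1 : ℤ) (-(a 0 1 : ℤ) : ℝ) (-(a 1 0 : ℤ) : ℝ) (a 0 0 : ℤ)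
      (actV (a 0 0 : ℤ) (a 0 1 : ℤ) (a 1 0 : ℤ) (a 1 1 : ℤ) x) = x := by
    intro x
    rw [actV_actV]
    have e1 : ((a 0 0 : ℤ) : ℝ) * (a 1 1 : ℤ) + (a 0 1 : ℤ) * (-(a 1 0 : ℤ) : ℝ) = 1 := by
      linear_combination hdet
    have e2 : ((a 0 0 : ℤ) : ℝ) * (-(a 0 1 : ℤ) : ℝ) + (a 0 1 : ℤ) * ((a 0 0 : ℤ) : ℝ) = 0 := by ring
    have e3 : ((a 1 0 : ℤ) : ℝ) * (a 1 1 : ℤ) + (a 1 1 : ℤ) * (-(a 1 0 : ℤ) : ℝ) = 0 := by ring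
    have e4 : ((a 1 0 : ℤ) : ℝ) * (-(a 0 1 : ℤ) : ℝ) + (a 1 1 : ℤ) * ((a 0 0 : ℤ) : ℝ) = 1 := by
      linear_combination hdet
    rw [e1, e2, e3, e4, actV_id]
  have := congrArg (actV (a 1 1 : ℤ) (-(a 0 1 : ℤ) : ℝ) (-(a 1 0 : ℤ) : ℝ) (a 0 0 : ℤ)) hv
  rw [hinv, hinv] at this
  exact latSharp32_injective this

/-- **The kernel series at a translate is dominated by the full theta sum at `τ`.** [folklore] -/
theorem tsum_norm_shintaniFn_smul_le32 (a : SL(2, ℤ)) (τ Z : ℍ) :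
    ∑' k : Fin 3 → ℤ, ‖shintaniFn (a • τ) Z (latSharp32 k)‖ ≤
      (‖denom (a : GL (Fin 2) ℝ) τ‖ ^ 2)⁻¹ *
        ∑' m : Fin 3 → ℤ, ‖formEval (vec m) τ‖ * Real.exp (-(2 * π * Z.im) * majorant τ (vec m)) := by
  have hd0 : denom (a : GL (Fin 2) ℝ) τ ≠ 0 := denom_ne_zero _ _
  have hdn : 0 < ‖denom (a : GL (Fin 2) ℝ) τ‖ := norm_pos_iff.mpr hd0
  have hden : (((a 1 0 : ℤ) : ℂ) * τ + ((a 1 1 : ℤ) : ℂ)) = denom (a : GL (Fin 2) ℝ) τ := by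
    rw [ModularGroup.denom_apply]
  set g : (Fin 3 → ℤ) → ℝ := fun m ↦ ‖formEval (vec m) τ‖ *
    Real.exp (-(2 * π * Z.im) * majorant τ (vec m)) with hgdef
  have hterm : ∀ k : Fin 3 → ℤ, ‖shintaniFn (a • τ) Z (latSharp32 k)‖ =
      (‖denom (a : GL (Fin 2) ℝ) τ‖ ^ 2)⁻¹ * g (intAct32 a k) := by
    intro k
    have h := shintaniFn_sl_smul a τ Z (latSharp32 k)
    rw [hden, ← vec_intAct32] at h
    have h' : shintaniFn (a • τ) Z (latSharp32 k) =
        shintaniFn τ Z (vec (intAct32 a k)) / (denom (a : GL (Fin 2) ℝ) τ) ^ 2 := by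
      rw [eq_div_iff (pow_ne_zero _ hd0), mul_comm]
      exact h.symm
    rw [h', norm_div, norm_pow, norm_shintaniFn, hgdef]
    dsimp only
    rw [show -(2 * π * Z.im * majorant τ (vec (intAct32 a k))) =
      -(2 * π * Z.im) * majorant τ (vec (intAct32 a k)) by ring]
    field_simp
  have ha : 0 < 2 * π * Z.im := by have := Z.im_pos; positivity
  have hS : Summable g := (tsum_norm_formEval_mul_exp_le ha τ.im_pos τ le_rfl).1
  calc ∑' k : Fin 3 → ℤ, ‖shintaniFn (a • τ) Z (latSharp32 k)‖
      = ∑' k : Fin 3 → ℤ, (‖denom (a : GL (Fin 2) ℝ) τ‖ ^ 2)⁻¹ * g (intAct32 a k) := tsum_congr hterm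
    _ = (‖denom (a : GL (Fin 2) ℝ) τ‖ ^ 2)⁻¹ * ∑' k : Fin 3 → ℤ, g (intAct32 a k) := tsum_mul_left
    _ ≤ (‖denom (a : GL (Fin 2) ℝ) τ‖ ^ 2)⁻¹ * ∑' m : Fin 3 → ℤ, g m := by
        refine mul_le_mul_of_nonneg_left ?_ (by positivity)
        exact tsum_comp_le_tsum_of_inj hS (fun m ↦ by positivity) (intAct32_injective a)

/-- **The kernel at a translate**: for `Im τ ≥ 1/2`,
`‖K₃₂,D(aτ; z)‖ ≤ √(Im z) ‖cτ+d‖⁻² C_z (Im τ)²`. [cite: Shintani1975, §2] -/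
theorem norm_kerD32_smul_le (a : SL(2, ℤ)) (z τ : ℍ) (hτ : 1 / 2 ≤ τ.im) :
    ‖kerD32 D (a • τ) z‖ ≤ Real.sqrt z.im * (‖denom (a : GL (Fin 2) ℝ) τ‖ ^ 2)⁻¹ *
      (thetaZ (2 * ((2 * π * (mulPos (1 / (128 * D)) (scale32_pos D) z).im) / 2) * (1 / 2) ^ 2) *
        thetaZ ((2 * π * (mulPos (1 / (128 * D)) (scale32_pos D) z).im) / 2) *
        thetaZ (2 * ((2 * π * (mulPos (1 / (128 * D)) (scale32_pos D) z).im) / 2) / (1 / 2) ^ 2) /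
        ((1 / 2) * Real.sqrt (2 * (2 * π * (mulPos (1 / (128 * D)) (scale32_pos D) z).im))) * τ.im ^ 2) := by
  set Z : ℍ := mulPos (1 / (128 * D)) (scale32_pos D) z with hZ
  have ha : 0 < 2 * π * Z.im := by have := Z.im_pos; positivity
  obtain ⟨hS, hB⟩ := tsum_norm_formEval_mul_exp_le ha (half_pos one_pos) τ hτ
  unfold kerD32 genKernel32
  rw [norm_mul, Complex.norm_real, Real.norm_of_nonneg (Real.sqrt_nonneg _), mul_assoc]
  refine mul_le_mul_of_nonneg_left ?_ (Real.sqrt_nonneg _)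
  have hs1 : Summable fun k : Fin 3 → ℤ ↦ ‖shintaniFn (a • τ) Z (latSharp32 k)‖ := by
    have := summable_term32 (c := fun _ ↦ (1 : ℂ)) ⟨1, fun _ ↦ by simp⟩ (a • τ) Z
    simpa using this.norm
  calc ‖∑' k : Fin 3 → ℤ, cD32 D k * shintaniFn (a • τ) Z (latSharp32 k)‖
      ≤ ∑' k : Fin 3 → ℤ, ‖cD32 D k * shintaniFn (a • τ) Z (latSharp32 k)‖ := norm_tsum_le_tsum_norm
          ((summable_term32 (bddWeight_cD32 D) (a • τ) Z).norm)
    _ ≤ ∑' k : Fin 3 → ℤ, ‖shintaniFn (a • τ) Z (latSharp32 k)‖ := by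
        refine Summable.tsum_le_tsum (fun k ↦ ?_) ((summable_term32 (bddWeight_cD32 D) (a • τ) Z).norm) hs1
        rw [norm_mul]
        exact mul_le_of_le_one_left (norm_nonneg _) (norm_cD32_le_one D k)
    _ ≤ _ := tsum_norm_shintaniFn_smul_le32 a τ Z
    _ ≤ _ := by
        refine mul_le_mul_of_nonneg_left hB (by positivity)

end KernelBound

/-! ### Measurability of the kernel in `w` -/

section Measurability

variable (D : ℕ) [NeZero D]

/-- `w ↦ K₃₂,D(w, z)` is measurable (limit of the continuous partial sums). [folklore] -/
theorem measurable_kerD32 (z : ℍ) : Measurable fun w : ℍ ↦ kerD32 D w z := by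
  set Z : ℍ := mulPos (1 / (128 * D)) (scale32_pos D) z with hZ
  have hcont : ∀ k : Fin 3 → ℤ, Continuous fun w : ℍ ↦ cD32 D k * shintaniFn w Z (latSharp32 k) :=
    fun k ↦ continuous_const.mul (continuous_shintaniFn_left Z _)
  have hlim : Tendsto (fun s : Finset (Fin 3 → ℤ) ↦ fun w : ℍ ↦
      ∑ k ∈ s, cD32 D k * shintaniFn w Z (latSharp32 k)) atTop
      (𝓝 fun w ↦ ∑' k : Fin 3 → ℤ, cD32 D k * shintaniFn w Z (latSharp32 k)) :=
    tendsto_pi_nhds.mpr fun w ↦ (summable_term32 (bddWeight_cD32 D) w Z).hasSum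
  have hm : Measurable fun w : ℍ ↦ ∑' k : Fin 3 → ℤ, cD32 D k * shintaniFn w Z (latSharp32 k) :=
    measurable_of_tendsto_metrizable' atTop
      (fun s ↦ (continuous_finsetSum s fun k _ ↦ hcont k).measurable) hlim
  have hsqrt : Measurable fun w : ℍ ↦ ((Real.sqrt z.im : ℝ) : ℂ) := measurable_const
  unfold kerD32 genKernel32
  exact hsqrt.mul hm

end Measurability

/-! ### The lift: domain, definition, invariance, integrability, automorphy -/

section Lift

variable (D : ℕ) [NeZero D]

/-- The integrand `h_z(w) = φ(w) K₃₂,D(w, z)` of the theta lift. [cite: Shintani1975, §2 (2.1)] -/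
def liftIntegrand32 (φ : ℍ → ℂ) (z w : ℍ) : ℂ := φ w * kerD32 D w z

/-- **`Γ₀(32)`-invariance of the integrand** (`D` odd): `φ` has weight `2`, `w ↦ K₃₂,D(w,z)` weight
`-2`. [cite: Shintani1975, §2 (2.1), (2.12)] -/
theorem liftIntegrand32_smul (hD : Odd D) (f : CuspForm (Gamma0 32) 2) (z : ℍ) {γ : SL(2, ℤ)}
    (hγ : γ ∈ Gamma0 32) (w : ℍ) :
    liftIntegrand32 D f z (γ • w) = liftIntegrand32 D f z w := by
  unfold liftIntegrand32
  have hmem : (γ : GL (Fin 2) ℝ) ∈ (Gamma0 32 : Subgroup (GL (Fin 2) ℝ)) := ⟨γ, hγ, rfl⟩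
  have h1 : f (γ • w) = (denom (γ : GL (Fin 2) ℝ) w) ^ (2 : ℤ) * f w := by
    have := SlashInvariantForm.slash_action_eqn'' f hmem w
    simpa using this
  have h32 : (32 : ℤ) ∣ γ 1 0 := by
    have h0 : ((γ 1 0 : ℤ) : ZMod 32) = 0 := Gamma0_mem.mp hγ
    exact (ZMod.intCast_zmod_eq_zero_iff_dvd _ 32).mp h0
  have h2 := genKernel32_sl_smul (invWeight32_cD32 hD) (1 / (128 * D)) (scale32_pos D) γ h32 w z
  rw [ModularGroup.denom_apply] at h1
  unfold kerD32
  rw [h1, zpow_ofNat]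
  linear_combination (f w) * h2

/-- A system of representatives of `SL₂(ℤ)/Γ₀(32)` in `SL₂(ℤ)`. [folklore] -/
def reps32 : (↥𝒮ℒ ⧸ (Gamma0 32 : Subgroup (GL (Fin 2) ℝ)).subgroupOf 𝒮ℒ) → SL(2, ℤ) :=
  Classical.choose (exists_mapGL_eq_out (N := 32))

/-- The defining property of `reps32`. [folklore] -/
theorem reps32_spec : ∀ q, (Matrix.SpecialLinearGroup.mapGL ℝ (reps32 q) : GL (Fin 2) ℝ) =
    ((q.out : ↥𝒮ℒ) : GL (Fin 2) ℝ) :=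
  Classical.choose_spec (exists_mapGL_eq_out (N := 32))

/-- The fundamental domain `F = ⋃_q g_q⁻¹ 𝒟ᵒ` of `Γ₀(32)` used for the lift. [folklore] -/
def liftDomain32 : Set ℍ := ⋃ q, {τ : ℍ | reps32 q • τ ∈ 𝒟ᵒ}

/-- `liftDomain32` is measurable (a finite union of open sets). [folklore] -/
theorem measurableSet_liftDomain32 : MeasurableSet liftDomain32 := by
  haveI := Fintype.ofFinite (↥𝒮ℒ ⧸ (Gamma0 32 : Subgroup (GL (Fin 2) ℝ)).subgroupOf 𝒮ℒ)
  exact MeasurableSet.iUnion fun q ↦ (isOpen_setOf_smul_mem_fdo (reps32 q)).measurableSet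

/-- **Shintani's theta lift at level `32`**: `Φ₃₂,D(z) = ∫_{Γ₀(32)∖ℍ} φ(w) K₃₂,D(w, z) dμ(w)`.
Weight `3/2`, level `128`, trivial character in `z` (below). [cite: Shintani1975, §2 (2.1), Thm. 2] -/
def shintaniLift32 (φ : ℍ → ℂ) (z : ℍ) : ℂ := ∫ w in liftDomain32, φ w * kerD32 D w z

/-- **The lift is `θ`-automorphic of weight `3/2` on `Γ₀(128)` with trivial character** (for `D`
odd square-free), by the level-`128` law of `K₃₂,D` under the integral sign.
[cite: Shintani1975, §2 Thm. 2] -/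
theorem isThetaAutomorphic_shintaniLift32 (hsq : Squarefree D) (hodd : Odd D) (φ : ℍ → ℂ) :
    IsThetaAutomorphic 3 128 1 (shintaniLift32 D φ) := by
  intro γ hγ z
  unfold shintaniLift32
  rw [← integral_mul_const, ← integral_const_mul]
  congr 1
  funext w
  have hK := isThetaAutomorphic_kerD32 D hsq hodd w γ hγ z
  simp only at hK
  linear_combination (φ w) * hK

/-- **Integrability on a translate of the open fundamental domain.** [cite: Shintani1975, §2, Prop. 2.1] -/
theorem integrableOn_liftIntegrand32_smul_fdo (f : CuspForm (Gamma0 32) 2) (z : ℍ) (s : SL(2, ℤ)) :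
    IntegrableOn (liftIntegrand32 D f z) {τ : ℍ | s • τ ∈ 𝒟ᵒ} := by
  set sG : GL (Fin 2) ℝ := (s : GL (Fin 2) ℝ) with hsG
  have hmp : MeasurePreserving (fun τ : ℍ ↦ sG • τ) volume volume := measurePreserving_smul _ _
  have hme : MeasurableEmbedding (fun τ : ℍ ↦ sG • τ) :=
    (MeasurableEquiv.smul sG).measurableEmbedding
  have hset : {τ : ℍ | s • τ ∈ 𝒟ᵒ} = (fun τ : ℍ ↦ sG • τ) ⁻¹' 𝒟ᵒ := by
    ext τ; simp [hsG]
  have hfun : liftIntegrand32 D f z =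
      (fun σ ↦ liftIntegrand32 D f z (sG⁻¹ • σ)) ∘ (fun τ : ℍ ↦ sG • τ) := by
    funext τ; simp
  rw [hset, hfun, hmp.integrableOn_comp_preimage hme]
  set a : SL(2, ℤ) := s⁻¹ with ha
  have haG : ∀ σ : ℍ, sG⁻¹ • σ = a • σ := by
    intro σ
    simp [ha, hsG, ModularGroup.sl_moeb, map_inv]
  simp_rw [haG]
  obtain ⟨B, c, hc, hB0, hB⟩ := exists_decay_translate f a
  set Cz : ℝ := thetaZ (2 * ((2 * π * (mulPos (1 / (128 * D)) (scale32_pos D) z).im) / 2) * (1 / 2) ^ 2) *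
      thetaZ ((2 * π * (mulPos (1 / (128 * D)) (scale32_pos D) z).im) / 2) *
      thetaZ (2 * ((2 * π * (mulPos (1 / (128 * D)) (scale32_pos D) z).im) / 2) / (1 / 2) ^ 2) /
      ((1 / 2) * Real.sqrt (2 * (2 * π * (mulPos (1 / (128 * D)) (scale32_pos D) z).im))) with hCz
  have hCz0 : 0 ≤ Cz := by
    rw [hCz]
    have := (mulPos (1 / (128 * D)) (scale32_pos D) z).im_pos
    refine div_nonneg (mul_nonneg (mul_nonneg (thetaZ_nonneg _) (thetaZ_nonneg _)) (thetaZ_nonneg _)) ?_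
    positivity
  set M : ℝ := B * (Real.sqrt z.im * Cz) * (4 / c ^ 2) with hM
  refine Measure.integrableOn_of_bounded (M := M)
    ((measure_mono ModularGroup.fdo_subset_fd).trans_lt volume_fd_lt_top).ne ?_ ?_
  · have hφ : Continuous fun σ : ℍ ↦ f (a • σ) :=
      (CuspFormClass.holo f).continuous.comp (continuous_sl2z_smul a)
    have hK : Measurable fun σ : ℍ ↦ kerD32 D (a • σ) z :=
      (measurable_kerD32 D z).comp (continuous_sl2z_smul a).measurable
    exact (hφ.measurable.mul hK).aestronglyMeasurable
  · rw [ae_restrict_iff' ModularGroup.isOpen_fdo.measurableSet]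
    refine ae_of_all _ fun σ hσ ↦ ?_
    have hσ2 : 1 / 2 ≤ σ.im :=
      ((mem_verticalStrip_iff _ _ _).mp (fd_subset_verticalStrip (ModularGroup.fdo_subset_fd hσ))).2
    have hd0 : denom (a : GL (Fin 2) ℝ) σ ≠ 0 := denom_ne_zero _ _
    have hdn : 0 < ‖denom (a : GL (Fin 2) ℝ) σ‖ := norm_pos_iff.mpr hd0
    unfold liftIntegrand32
    rw [norm_mul]
    have h1 := hB σ hσ2
    have h2 := norm_kerD32_smul_le D a z σ hσ2
    rw [← hCz] at h2
    have h3 := sq_mul_exp_neg_le hc σ.im_pos.le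
    calc ‖f (a • σ)‖ * ‖kerD32 D (a • σ) z‖
        ≤ (B * ‖denom (a : GL (Fin 2) ℝ) σ‖ ^ 2 * Real.exp (-c * σ.im)) *
          (Real.sqrt z.im * (‖denom (a : GL (Fin 2) ℝ) σ‖ ^ 2)⁻¹ * (Cz * σ.im ^ 2)) :=
          mul_le_mul h1 h2 (norm_nonneg _) (by positivity)
      _ = B * (Real.sqrt z.im * Cz) * (σ.im ^ 2 * Real.exp (-c * σ.im)) := by
          field_simp
      _ ≤ B * (Real.sqrt z.im * Cz) * (4 / c ^ 2) := by
          gcongr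
      _ = M := by rw [hM]

/-- **Integrability of the lift's integrand on the fundamental domain.** [cite: Shintani1975, §2, Prop. 2.1] -/
theorem integrableOn_liftIntegrand32 (f : CuspForm (Gamma0 32) 2) (z : ℍ) :
    IntegrableOn (liftIntegrand32 D f z) liftDomain32 := by
  haveI := Fintype.ofFinite (↥𝒮ℒ ⧸ (Gamma0 32 : Subgroup (GL (Fin 2) ℝ)).subgroupOf 𝒮ℒ)
  unfold liftDomain32
  exact (integrableOn_finite_iUnion).mpr fun q ↦ integrableOn_liftIntegrand32_smul_fdo D f z (reps32 q)

/-- The lift of a cusp form as the integral of `liftIntegrand32`. [folklore] -/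
theorem shintaniLift32_eq (φ : ℍ → ℂ) (z : ℍ) :
    shintaniLift32 D φ z = ∫ w in liftDomain32, liftIntegrand32 D φ z w := rfl

end Lift

end Literature.NumberTheory.EllipticCurves.Shintani

noncomputable section

open scoped MatrixGroups ModularForm Modular Topology ENNReal Pointwise
open UpperHalfPlane hiding I
open Complex Filter MeasureTheory Set CongruenceSubgroup ModularGroup Real
open Literature.NumberTheory.EllipticCurves.ModularForms

namespace Literature.NumberTheory.EllipticCurves.Shintani

/-! ### The action `γ • k = k ∘ γ⁻¹` of `Γ₀(32)⁺` on `ℤ³` -/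

section Action

/-- `c/32` for `γ ∈ Γ₀(32)⁺`. [folklore] -/
def cq32 (γ : Gamma0Plus 32) : ℤ := ((γ : SL(2, ℤ)) 1 0 : ℤ) / 32

/-- `32 · (c/32) = c` on `Γ₀(32)⁺`. [folklore] -/
theorem thirtytwo_mul_cq32 (γ : Gamma0Plus 32) : 32 * cq32 γ = ((γ : SL(2, ℤ)) 1 0 : ℤ) := by
  have h : (32 : ℤ) ∣ ((γ : SL(2, ℤ)) 1 0 : ℤ) := by
    have h0 : ((((γ : SL(2, ℤ)) 1 0 : ℤ)) : ZMod 32) = 0 := Gamma0_mem.mp (Gamma0Plus_le γ.2)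
    exact (ZMod.intCast_zmod_eq_zero_iff_dvd _ 32).mp h0
  exact Int.mul_ediv_cancel' h

/-- The entries of a product in `Γ₀(32)⁺`. [folklore] -/
theorem coe_mul_apply32 (γ δ : Gamma0Plus 32) (i j : Fin 2) :
    (((γ * δ : Gamma0Plus 32) : SL(2, ℤ)) i j : ℤ) =
      (γ : SL(2, ℤ)) i 0 * (δ : SL(2, ℤ)) 0 j + (γ : SL(2, ℤ)) i 1 * (δ : SL(2, ℤ)) 1 j := by
  rw [Subgroup.coe_mul]; simp [Matrix.mul_apply, Fin.sum_univ_two]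

/-- `cq32(γδ) = cq32(γ) δ₀₀ + γ₁₁ cq32(δ)`. [folklore] -/
theorem cq32_mul (γ δ : Gamma0Plus 32) :
    cq32 (γ * δ) = cq32 γ * (δ : SL(2, ℤ)) 0 0 + (γ : SL(2, ℤ)) 1 1 * cq32 δ := by
  have hγc := thirtytwo_mul_cq32 γ
  have hδc := thirtytwo_mul_cq32 δ
  have hπc := thirtytwo_mul_cq32 (γ * δ)
  have e10 := coe_mul_apply32 γ δ 1 0
  have : 32 * cq32 (γ * δ) = 32 * (cq32 γ * (δ : SL(2, ℤ)) 0 0 + (γ : SL(2, ℤ)) 1 1 * cq32 δ) := by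
    rw [hπc, e10, ← hγc, ← hδc]; ring
  linarith

/-- The action map `γ • k := k ∘ γ⁻¹` on coordinates of `L♮₃₂`. [cite: Shintani1975, §2 (2.8)] -/
def latSmul32 (γ : Gamma0Plus 32) (k : Fin 3 → ℤ) : Fin 3 → ℤ :=
  actSharp32 ((γ : SL(2, ℤ)) 1 1) (-((γ : SL(2, ℤ)) 0 1)) (-cq32 γ) ((γ : SL(2, ℤ)) 0 0) k

/-- `1 • k = k`. [folklore] -/
theorem latSmul32_one (k : Fin 3 → ℤ) : latSmul32 1 k = k := by
  unfold latSmul32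
  have hc : cq32 1 = 0 := by unfold cq32; simp
  rw [hc]
  simpa using actSharp32_one k

/-- `(γδ) • k = γ • (δ • k)`. [folklore] -/
theorem latSmul32_mul (γ δ : Gamma0Plus 32) (k : Fin 3 → ℤ) :
    latSmul32 (γ * δ) k = latSmul32 γ (latSmul32 δ k) := by
  unfold latSmul32
  rw [actSharp32_actSharp32, coe_mul_apply32 γ δ 1 1, coe_mul_apply32 γ δ 0 1, coe_mul_apply32 γ δ 0 0,
    cq32_mul]
  have hγc := thirtytwo_mul_cq32 γ
  have hδc := thirtytwo_mul_cq32 δ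
  congr 1
  · linear_combination (-((δ : SL(2, ℤ)) 0 1 : ℤ)) * hγc
  · ring
  · ring
  · linear_combination (-((γ : SL(2, ℤ)) 0 1 : ℤ)) * hδc

/-- **The (left) action of `Γ₀(32)⁺` on the coordinates `k ∈ ℤ³` of `L♮₃₂`.** [cite: Shintani1975, §2 (2.8)] -/
instance latMulAction32 : MulAction (Gamma0Plus 32) (Fin 3 → ℤ) where
  smul := latSmul32
  one_smul := latSmul32_one
  mul_smul := latSmul32_mul

/-- Unfolding the action. [folklore] -/
theorem smul_def32 (γ : Gamma0Plus 32) (k : Fin 3 → ℤ) :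
    γ • k = actSharp32 ((γ : SL(2, ℤ)) 1 1) (-((γ : SL(2, ℤ)) 0 1)) (-cq32 γ) ((γ : SL(2, ℤ)) 0 0) k := rfl

/-- **`ι♮₃₂(γ • k) = ι♮₃₂(k) ∘ γ⁻¹`** on `V`. [folklore] -/
theorem latSharp32_smul (γ : Gamma0Plus 32) (k : Fin 3 → ℤ) :
    latSharp32 (γ • k) = actV ((γ : SL(2, ℤ)) 1 1 : ℤ) ((-((γ : SL(2, ℤ)) 0 1) : ℤ) : ℝ)
      ((-((γ : SL(2, ℤ)) 1 0) : ℤ) : ℝ) ((γ : SL(2, ℤ)) 0 0 : ℤ) (latSharp32 k) := by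
  rw [smul_def32, latSharp32_actSharp32]
  congr 1
  rw [← thirtytwo_mul_cq32 γ]; push_cast; ring

/-- The discriminant is invariant: `disc ι♮₃₂(γ • k) = disc ι♮₃₂(k)`. [folklore] -/
theorem disc_latSharp32_smul (γ : Gamma0Plus 32) (k : Fin 3 → ℤ) :
    disc (latSharp32 (γ • k)) = disc (latSharp32 k) := by
  rw [latSharp32_smul, disc_actV]
  have hdet : (((γ : SL(2, ℤ)) 1 1 : ℤ) : ℝ) * (((γ : SL(2, ℤ)) 0 0 : ℤ) : ℝ) -
      ((-((γ : SL(2, ℤ)) 0 1) : ℤ) : ℝ) * ((-((γ : SL(2, ℤ)) 1 0) : ℤ) : ℝ) = 1 := by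
    have h : ((γ : SL(2, ℤ)) 0 0 : ℝ) * (γ : SL(2, ℤ)) 1 1 - (γ : SL(2, ℤ)) 0 1 * (γ : SL(2, ℤ)) 1 0 = 1 := by
      exact_mod_cast det_eq_one' (γ : SL(2, ℤ))
    push_cast
    linear_combination h
  rw [hdet, one_pow, one_mul]

/-- A `Γ₀(32)`-invariant weight is invariant under the action: `c(γ • k) = c(k)`. [folklore] -/
theorem invWeight32_smul {c : (Fin 3 → ℤ) → ℂ} (hc : InvWeight32 c) (γ : Gamma0Plus 32) (k : Fin 3 → ℤ) :
    c (γ • k) = c k := by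
  rw [smul_def32]
  refine hc _ _ _ _ ?_ k
  have := det_eq_one' (γ : SL(2, ℤ))
  have h32 := thirtytwo_mul_cq32 γ
  linear_combination this - ((γ : SL(2, ℤ)) 0 1 : ℤ) * h32

/-- **Equivariance of the kernel terms**: `f_{w,Z}(ι♮₃₂(γ • k)) = j(γ⁻¹, w)² f_{γ⁻¹ w, Z}(ι♮₃₂ k)`.
[cite: Shintani1975, (2.12)] -/
theorem shintaniFn_latSharp32_smul (γ : Gamma0Plus 32) (k : Fin 3 → ℤ) (w Z : ℍ) :
    shintaniFn w Z (latSharp32 (γ • k)) =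
      ((((γ : SL(2, ℤ))⁻¹ 1 0 : ℤ) : ℂ) * w + (((γ : SL(2, ℤ))⁻¹ 1 1 : ℤ) : ℂ)) ^ 2 *
        shintaniFn ((γ : SL(2, ℤ))⁻¹ • w) Z (latSharp32 k) := by
  obtain ⟨h00, h01, h10, h11⟩ := inv_apply (γ : SL(2, ℤ))
  rw [latSharp32_smul, ← shintaniFn_sl_smul, h00, h01, h10, h11]

/-- **Definite vectors have trivial stabilisers in `Γ₀(32)⁺`.** [folklore] -/
theorem eq_one_of_smul_eq_of_disc_neg32 {k : Fin 3 → ℤ} (hk : disc (latSharp32 k) < 0) {γ : Gamma0Plus 32}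
    (hγ : γ • k = k) : γ = 1 := by
  set x : V := latSharp32 k with hxdef
  have hx0 : x 0 ≠ 0 := by
    intro h0
    have : disc x = x 1 ^ 2 := by rw [disc, h0]; ring
    rw [this] at hk
    nlinarith [sq_nonneg (x 1)]
  obtain ⟨ω, hωim, hω⟩ : ∃ ω : ℂ, 0 < ω.im ∧ formEval x ω = 0 := by
    set s : ℝ := Real.sqrt (-disc x) with hs
    have hs2 : s ^ 2 = -disc x := Real.sq_sqrt (by linarith)
    have hspos : 0 < s := Real.sqrt_pos.mpr (by linarith)
    set p : ℝ := -x 1 / (2 * x 0) with hp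
    set q : ℝ := s / (2 * |x 0|) with hq
    have habs : 0 < |x 0| := abs_pos.mpr hx0
    have hqpos : 0 < q := by positivity
    have hp' : 2 * x 0 * p + x 1 = 0 := by rw [hp]; field_simp; ring
    have hq2 : 4 * x 0 ^ 2 * q ^ 2 = s ^ 2 := by
      rw [hq, div_pow, mul_pow, sq_abs]; field_simp; norm_num
    have hreal : x 0 * (p * p - q * q) + x 1 * p + x 2 = 0 := by
      have hx4 : (4 : ℝ) * x 0 ≠ 0 := by positivity
      have key : (x 0 * (p * p - q * q) + x 1 * p + x 2) * (4 * x 0) = 0 := by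
        have hd : disc x = x 1 ^ 2 - 4 * x 0 * x 2 := rfl
        nlinarith [hp', hq2, hs2, hd]
      rcases mul_eq_zero.mp key with h | h
      · exact h
      · exact absurd h hx4
    have himag : x 0 * (2 * p * q) + x 1 * q = 0 := by nlinarith [hp']
    refine ⟨(p : ℂ) + (q : ℂ) * I, by simpa using hqpos, ?_⟩
    rw [formEval, Complex.ext_iff]
    constructor
    · simp only [pow_two, add_re, mul_re, mul_im, add_im, Complex.ofReal_re, Complex.ofReal_im,
        Complex.I_re, Complex.I_im, mul_zero, sub_zero, zero_mul, add_zero, mul_one, Complex.zero_re]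
      linear_combination hreal
    · simp only [pow_two, add_re, mul_re, mul_im, add_im, Complex.ofReal_re, Complex.ofReal_im,
        Complex.I_re, Complex.I_im, mul_zero, sub_zero, zero_mul, add_zero, mul_one, zero_add,
        Complex.zero_im]
      linear_combination himag
  set g : SL(2, ℤ) := (γ : SL(2, ℤ))⁻¹ with hg
  obtain ⟨h00, h01, h10, h11⟩ := inv_apply (γ : SL(2, ℤ))
  have hfixV : actV ((g 0 0 : ℤ)) ((g 0 1 : ℤ)) ((g 1 0 : ℤ)) ((g 1 1 : ℤ)) x = x := by
    rw [hg, h00, h01, h10, h11, ← latSharp32_smul, hγ]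
  let ωH : ℍ := ⟨ω, hωim⟩
  have hden : ((g 1 0 : ℤ) : ℂ) * ω + ((g 1 1 : ℤ) : ℂ) ≠ 0 := by
    have h := UpperHalfPlane.denom_ne_zero (g : GL (Fin 2) ℝ) ωH
    rw [ModularGroup.denom_apply] at h
    exact_mod_cast h
  have hroot' : formEval x ((((g 0 0 : ℤ) : ℂ) * ω + (g 0 1 : ℤ)) / (((g 1 0 : ℤ) : ℂ) * ω + (g 1 1 : ℤ))) = 0 := by
    have h := formEval_actV ((g 0 0 : ℤ)) ((g 0 1 : ℤ)) ((g 1 0 : ℤ)) ((g 1 1 : ℤ)) x (u := ω)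
      (by exact_mod_cast hden)
    rw [hfixV, hω] at h
    push_cast at h ⊢
    rcases mul_eq_zero.mp h.symm with h1 | h1
    · exact absurd (pow_eq_zero_iff two_ne_zero |>.mp h1) (by exact_mod_cast hden)
    · exact h1
  have hgω : ((g • ωH : ℍ) : ℂ) = ((((g 0 0 : ℤ) : ℂ) * ω + (g 0 1 : ℤ)) / (((g 1 0 : ℤ) : ℂ) * ω + (g 1 1 : ℤ))) := by
    rw [coe_smul_eq']
  have hfix : g • ωH = ωH := by
    apply UpperHalfPlane.ext
    rw [hgω]
    exact root_unique hx0 (by rw [← hgω]; exact (g • ωH).im_pos) hωim hroot' hω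
  have hg1 : g = 1 := eq_one_of_mem_Gamma0Plus_of_smul_eq ((Gamma0Plus 32).inv_mem γ.2) hfix
  have : (γ : SL(2, ℤ)) = 1 := by
    have := congrArg (·⁻¹) hg1
    simpa [hg] using this
  exact Subtype.ext this

end Action

/-! ### Termwise integration -/

section Termwise

variable (D : ℕ) [NeZero D]

/-- The scaled variable `Z = z/(128 D)` of the kernel. [folklore] -/
abbrev zScaled32 (z : ℍ) : ℍ := mulPos (1 / (128 * D)) (scale32_pos D) z

/-- The `k`-th term of the lift's integrand: `φ(w) c_D(k) f_{w,Z}(ι♮₃₂ k)`. [folklore] -/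
def liftTerm32 (φ : ℍ → ℂ) (z : ℍ) (k : Fin 3 → ℤ) (w : ℍ) : ℂ :=
  φ w * (cD32 D k * shintaniFn w (zScaled32 D z) (latSharp32 k))

/-- The kernel integrand is `√(Im z)` times the sum of the terms. [folklore] -/
theorem liftIntegrand32_eq_tsum (φ : ℍ → ℂ) (z w : ℍ) :
    liftIntegrand32 D φ z w = (Real.sqrt z.im : ℂ) * ∑' k : Fin 3 → ℤ, liftTerm32 D φ z k w := by
  simp only [liftTerm32]
  rw [tsum_mul_left, liftIntegrand32, kerD32, genKernel32]
  ring

/-- Each term is measurable in `w`. [folklore] -/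
theorem measurable_liftTerm32 {φ : ℍ → ℂ} (hφ : Measurable φ) (z : ℍ) (k : Fin 3 → ℤ) :
    Measurable (liftTerm32 D φ z k) :=
  hφ.mul ((continuous_const.mul (continuous_shintaniFn_left (zScaled32 D z) (latSharp32 k))).measurable)

/-- The pointwise bound for the sum of the norms of the terms on a translate. [folklore] -/
theorem tsum_norm_cD32_mul_le (a : SL(2, ℤ)) (z τ : ℍ) (hτ : 1 / 2 ≤ τ.im) :
    ∑' k : Fin 3 → ℤ, ‖cD32 D k * shintaniFn (a • τ) (zScaled32 D z) (latSharp32 k)‖ ≤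
      (‖denom (a : GL (Fin 2) ℝ) τ‖ ^ 2)⁻¹ *
      (thetaZ (2 * ((2 * π * (zScaled32 D z).im) / 2) * (1 / 2) ^ 2) *
        thetaZ ((2 * π * (zScaled32 D z).im) / 2) *
        thetaZ (2 * ((2 * π * (zScaled32 D z).im) / 2) / (1 / 2) ^ 2) /
        ((1 / 2) * Real.sqrt (2 * (2 * π * (zScaled32 D z).im))) * τ.im ^ 2) := by
  set Z : ℍ := zScaled32 D z with hZ
  have ha : 0 < 2 * π * Z.im := by have := Z.im_pos; positivity
  obtain ⟨hS, hB⟩ := tsum_norm_formEval_mul_exp_le ha (half_pos one_pos) τ hτ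
  have hs1 : Summable fun k : Fin 3 → ℤ ↦ ‖shintaniFn (a • τ) Z (latSharp32 k)‖ := by
    have := summable_term32 (c := fun _ ↦ (1 : ℂ)) ⟨1, fun _ ↦ by simp⟩ (a • τ) Z
    simpa using this.norm
  calc ∑' k : Fin 3 → ℤ, ‖cD32 D k * shintaniFn (a • τ) Z (latSharp32 k)‖
      ≤ ∑' k : Fin 3 → ℤ, ‖shintaniFn (a • τ) Z (latSharp32 k)‖ := by
        refine Summable.tsum_le_tsum (fun k ↦ ?_) ((summable_term32 (bddWeight_cD32 D) (a • τ) Z).norm) hs1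
        rw [norm_mul]
        exact mul_le_of_le_one_left (norm_nonneg _) (norm_cD32_le_one D k)
    _ ≤ _ := tsum_norm_shintaniFn_smul_le32 a τ Z
    _ ≤ _ := mul_le_mul_of_nonneg_left hB (by positivity)

/-- **Finiteness of `∑_k ∫ ‖term_k‖` on a translate of `𝒟ᵒ`.** [cite: Shintani1975, §2, Prop. 2.1] -/
theorem lintegral_tsum_enorm_liftTerm32_smul_fdo_lt_top (f : CuspForm (Gamma0 32) 2) (z : ℍ) (s : SL(2, ℤ)) :
    ∫⁻ τ in {τ : ℍ | s • τ ∈ 𝒟ᵒ}, ∑' k : Fin 3 → ℤ, ‖liftTerm32 D f z k τ‖ₑ < ∞ := by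
  set sG : GL (Fin 2) ℝ := (s : GL (Fin 2) ℝ) with hsG
  have hmp : MeasurePreserving (fun τ : ℍ ↦ sG • τ) volume volume := measurePreserving_smul _ _
  have hme : MeasurableEmbedding (fun τ : ℍ ↦ sG • τ) :=
    (MeasurableEquiv.smul sG).measurableEmbedding
  have hset : {τ : ℍ | s • τ ∈ 𝒟ᵒ} = (fun τ : ℍ ↦ sG • τ) ⁻¹' 𝒟ᵒ := by
    ext τ; simp [hsG]
  set G : ℍ → ℝ≥0∞ := fun τ ↦ ∑' k : Fin 3 → ℤ, ‖liftTerm32 D f z k τ‖ₑ with hGdef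
  change ∫⁻ τ in {τ : ℍ | s • τ ∈ 𝒟ᵒ}, G τ < ∞
  have h2 : ∫⁻ τ in (fun τ : ℍ ↦ sG • τ) ⁻¹' 𝒟ᵒ, G τ = ∫⁻ σ in 𝒟ᵒ, G (sG⁻¹ • σ) := by
    have := hmp.setLIntegral_comp_preimage_emb hme (fun σ ↦ G (sG⁻¹ • σ)) 𝒟ᵒ
    simp only [inv_smul_smul] at this
    exact this
  rw [hset, h2]
  set a : SL(2, ℤ) := s⁻¹ with ha
  have haG : ∀ σ : ℍ, sG⁻¹ • σ = a • σ := by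
    intro σ
    simp [ha, hsG, ModularGroup.sl_moeb, map_inv]
  simp_rw [haG]
  obtain ⟨B, c, hc, hB0, hB⟩ := exists_decay_translate f a
  set Cz : ℝ := thetaZ (2 * ((2 * π * (zScaled32 D z).im) / 2) * (1 / 2) ^ 2) *
      thetaZ ((2 * π * (zScaled32 D z).im) / 2) *
      thetaZ (2 * ((2 * π * (zScaled32 D z).im) / 2) / (1 / 2) ^ 2) /
      ((1 / 2) * Real.sqrt (2 * (2 * π * (zScaled32 D z).im))) with hCz
  have hCz0 : 0 ≤ Cz := by
    rw [hCz]
    have := (zScaled32 D z).im_pos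
    refine div_nonneg (mul_nonneg (mul_nonneg (thetaZ_nonneg _) (thetaZ_nonneg _)) (thetaZ_nonneg _)) ?_
    positivity
  set M : ℝ := B * Cz * (4 / c ^ 2) with hM
  have hpt : ∀ σ ∈ 𝒟ᵒ, G (a • σ) ≤ ENNReal.ofReal M := by
    intro σ hσ
    have hσ2 : 1 / 2 ≤ σ.im :=
      ((mem_verticalStrip_iff _ _ _).mp (fd_subset_verticalStrip (ModularGroup.fdo_subset_fd hσ))).2
    have hd0 : denom (a : GL (Fin 2) ℝ) σ ≠ 0 := denom_ne_zero _ _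
    have hdn : 0 < ‖denom (a : GL (Fin 2) ℝ) σ‖ := norm_pos_iff.mpr hd0
    have h1 := hB σ hσ2
    have h2 := tsum_norm_cD32_mul_le D a z σ hσ2
    rw [← hCz] at h2
    have h3 := sq_mul_exp_neg_le hc σ.im_pos.le
    have hsum : Summable fun k : Fin 3 → ℤ ↦ ‖cD32 D k * shintaniFn (a • σ) (zScaled32 D z) (latSharp32 k)‖ :=
      (summable_term32 (bddWeight_cD32 D) (a • σ) (zScaled32 D z)).norm
    have hG : G (a • σ) = ENNReal.ofReal (‖f (a • σ)‖ *
        ∑' k : Fin 3 → ℤ, ‖cD32 D k * shintaniFn (a • σ) (zScaled32 D z) (latSharp32 k)‖) := by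
      rw [hGdef]
      simp only [liftTerm32]
      rw [← tsum_mul_left, ENNReal.ofReal_tsum_of_nonneg (fun k ↦ by positivity) (hsum.mul_left _)]
      refine tsum_congr fun k ↦ ?_
      rw [← norm_mul, ofReal_norm]
    rw [hG]
    refine ENNReal.ofReal_le_ofReal ?_
    calc ‖f (a • σ)‖ * ∑' k : Fin 3 → ℤ, ‖cD32 D k * shintaniFn (a • σ) (zScaled32 D z) (latSharp32 k)‖
        ≤ (B * ‖denom (a : GL (Fin 2) ℝ) σ‖ ^ 2 * Real.exp (-c * σ.im)) *
          ((‖denom (a : GL (Fin 2) ℝ) σ‖ ^ 2)⁻¹ * (Cz * σ.im ^ 2)) :=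
          mul_le_mul h1 h2 (tsum_nonneg fun _ ↦ norm_nonneg _) (by positivity)
      _ = B * Cz * (σ.im ^ 2 * Real.exp (-c * σ.im)) := by field_simp
      _ ≤ B * Cz * (4 / c ^ 2) := by gcongr
      _ = M := by rw [hM]
  calc ∫⁻ σ in 𝒟ᵒ, G (a • σ) ≤ ∫⁻ _ in 𝒟ᵒ, ENNReal.ofReal M :=
        setLIntegral_mono measurable_const hpt
    _ = ENNReal.ofReal M * volume 𝒟ᵒ := setLIntegral_const _ _
    _ < ∞ := by
        refine ENNReal.mul_lt_top ENNReal.ofReal_lt_top ?_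
        exact (measure_mono ModularGroup.fdo_subset_fd).trans_lt volume_fd_lt_top

/-- **Finiteness of `∑_k ∫_F ‖term_k‖`** on the whole domain `F`. [cite: Shintani1975, §2, Prop. 2.1] -/
theorem tsum_lintegral_enorm_liftTerm32_ne_top (f : CuspForm (Gamma0 32) 2) (z : ℍ) :
    ∑' k : Fin 3 → ℤ, ∫⁻ w in liftDomain32, ‖liftTerm32 D f z k w‖ₑ ≠ ∞ := by
  haveI := Fintype.ofFinite (↥𝒮ℒ ⧸ (Gamma0 32 : Subgroup (GL (Fin 2) ℝ)).subgroupOf 𝒮ℒ)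
  have hmeas : ∀ k, Measurable (liftTerm32 D f z k) :=
    fun k ↦ measurable_liftTerm32 D (CuspFormClass.holo f).continuous.measurable z k
  rw [← lintegral_tsum fun k ↦ (hmeas k).enorm.aemeasurable]
  refine ne_of_lt ?_
  unfold liftDomain32
  calc ∫⁻ w in ⋃ q, {τ : ℍ | reps32 q • τ ∈ 𝒟ᵒ}, ∑' k, ‖liftTerm32 D f z k w‖ₑ
      ≤ ∑ q, ∫⁻ w in {τ : ℍ | reps32 q • τ ∈ 𝒟ᵒ}, ∑' k, ‖liftTerm32 D f z k w‖ₑ := by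
        refine (lintegral_iUnion_le _ _).trans ?_
        rw [tsum_fintype]
    _ < ∞ := by
        refine ENNReal.sum_lt_top.mpr fun q _ ↦ ?_
        exact lintegral_tsum_enorm_liftTerm32_smul_fdo_lt_top D f z (reps32 q)

/-- **Termwise integration**: `Φ₃₂,D(z) = √(Im z) ∑_k ∫_F φ(w) c_D(k) f_{w,Z}(ι♮₃₂ k) dμ(w)`.
[cite: Shintani1975, §2, (2.8)–(2.9)] -/
theorem shintaniLift32_eq_tsum_integral (f : CuspForm (Gamma0 32) 2) (z : ℍ) :
    shintaniLift32 D f z = (Real.sqrt z.im : ℂ) * ∑' k : Fin 3 → ℤ, ∫ w in liftDomain32, liftTerm32 D f z k w := by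
  have hmeas : ∀ k, Measurable (liftTerm32 D f z k) :=
    fun k ↦ measurable_liftTerm32 D (CuspFormClass.holo f).continuous.measurable z k
  rw [shintaniLift32_eq]
  simp_rw [liftIntegrand32_eq_tsum]
  rw [integral_const_mul, integral_tsum (fun k ↦ (hmeas k).aestronglyMeasurable)
    (tsum_lintegral_enorm_liftTerm32_ne_top D f z)]

end Termwise

/-! ### Unfolding orbit by orbit -/

section Unfolding

variable (D : ℕ) [NeZero D]

/-- **`term(γ • k)(w) = term(k)(γ⁻¹ w)`** for `γ ∈ Γ₀(32)⁺`, `φ ∈ S₂(Γ₀(32))`, `D` odd.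
[cite: Shintani1975, (2.12)] -/
theorem liftTerm32_smul (hD : Odd D) (f : CuspForm (Gamma0 32) 2) (z : ℍ) (γ : Gamma0Plus 32)
    (k : Fin 3 → ℤ) (w : ℍ) :
    liftTerm32 D f z (γ • k) w = liftTerm32 D f z k (((γ : SL(2, ℤ))⁻¹) • w) := by
  unfold liftTerm32
  set g : SL(2, ℤ) := (γ : SL(2, ℤ))⁻¹ with hg
  have hgmem : g ∈ Gamma0 32 := (Gamma0 32).inv_mem (Gamma0Plus_le γ.2)
  have hmem : (g : GL (Fin 2) ℝ) ∈ (Gamma0 32 : Subgroup (GL (Fin 2) ℝ)) := ⟨g, hgmem, rfl⟩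
  have h1 : f (g • w) = (denom (g : GL (Fin 2) ℝ) w) ^ (2 : ℤ) * f w := by
    have := SlashInvariantForm.slash_action_eqn'' f hmem w
    simpa using this
  rw [ModularGroup.denom_apply] at h1
  rw [invWeight32_smul (invWeight32_cD32 hD), shintaniFn_latSharp32_smul, ← hg, h1, zpow_ofNat]
  ring

/-- The lift's domain is the `Γ₀(32)⁺`-fundamental domain of `Gamma0FundamentalDomain`. [folklore] -/
theorem liftDomain32_eq_gamma0Domain : liftDomain32 = gamma0Domain reps32 := rfl

/-- `F` is a fundamental domain for `Γ₀(32)⁺`. [cite: DiamondShurman2005, §2.3–2.4] -/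
theorem isFundamentalDomain_liftDomain32 :
    IsFundamentalDomain (Gamma0Plus 32) liftDomain32 (volume : Measure ℍ) := by
  rw [liftDomain32_eq_gamma0Domain]
  exact isFundamentalDomain_gamma0Domain reps32 reps32_spec (by norm_num)

/-- The term integrals `k ↦ ∫_F term_k` are absolutely summable. [folklore] -/
theorem summable_norm_integral_liftTerm32 (f : CuspForm (Gamma0 32) 2) (z : ℍ) :
    Summable fun k : Fin 3 → ℤ ↦ ‖∫ w in liftDomain32, liftTerm32 D f z k w‖ := by
  have h := tsum_lintegral_enorm_liftTerm32_ne_top D f z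
  have hle : ∀ k, ‖∫ w in liftDomain32, liftTerm32 D f z k w‖ ≤
      (∫⁻ w in liftDomain32, ‖liftTerm32 D f z k w‖ₑ).toReal := by
    intro k
    refine (norm_integral_le_lintegral_norm _).trans (le_of_eq ?_)
    congr 1
    refine lintegral_congr fun w ↦ ?_
    rw [ofReal_norm]
  refine Summable.of_nonneg_of_le (fun _ ↦ norm_nonneg _) hle ?_
  exact ENNReal.summable_toReal h

variable {D}

section Orbit

variable (k₀ : Fin 3 → ℤ)

/-- The stabiliser `Γ_{k₀} ≤ Γ₀(32)⁺`. [folklore] -/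
abbrev stabK32 : Subgroup (Gamma0Plus 32) := MulAction.stabilizer (Gamma0Plus 32) k₀

/-- The inverses of the chosen coset representatives of `Γ₀(32)⁺/Γ_{k₀}`. [folklore] -/
def cosetRepInv32 : Set (Gamma0Plus 32) := Set.range fun q : Gamma0Plus 32 ⧸ stabK32 k₀ ↦ (q.out)⁻¹

/-- The covering property of the representatives. [folklore] -/
theorem cosetRepInv32_cov (g : Gamma0Plus 32) : ∃ r ∈ cosetRepInv32 k₀, r * g ∈ stabK32 k₀ := by
  refine ⟨((QuotientGroup.mk g : Gamma0Plus 32 ⧸ stabK32 k₀).out)⁻¹, ⟨_, rfl⟩, ?_⟩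
  obtain ⟨h, hh⟩ := QuotientGroup.mk_out_eq_mul (stabK32 k₀) g
  rw [hh, _root_.mul_inv_rev, inv_mul_cancel_right]
  exact (stabK32 k₀).inv_mem h.2

/-- The uniqueness property of the representatives. [folklore] -/
theorem cosetRepInv32_uniq (r : Gamma0Plus 32) (hr : r ∈ cosetRepInv32 k₀) (r' : Gamma0Plus 32)
    (hr' : r' ∈ cosetRepInv32 k₀) (h : r' * r⁻¹ ∈ stabK32 k₀) : r = r' := by
  obtain ⟨q, rfl⟩ := hr
  obtain ⟨q', rfl⟩ := hr'
  rw [inv_inv] at h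
  have : (QuotientGroup.mk q'.out : Gamma0Plus 32 ⧸ stabK32 k₀) = QuotientGroup.mk q.out :=
    QuotientGroup.eq.mpr h
  rw [QuotientGroup.out_eq', QuotientGroup.out_eq'] at this
  rw [this]

/-- The bijection `Γ₀(32)⁺/Γ_{k₀} ≃ R`, `q ↦ (q.out)⁻¹`. [folklore] -/
def quotEquivCosetRepInv32 : (Gamma0Plus 32 ⧸ stabK32 k₀) ≃ cosetRepInv32 k₀ :=
  Equiv.ofBijective (fun q ↦ ⟨(q.out)⁻¹, ⟨q, rfl⟩⟩) (by
    constructor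
    · intro q q' h
      have h1 : (q.out)⁻¹ = (q'.out)⁻¹ := congrArg Subtype.val h
      have h2 : q.out = q'.out := inv_injective h1
      rw [← QuotientGroup.out_eq' q, ← QuotientGroup.out_eq' q', h2]
    · rintro ⟨r, q, rfl⟩
      exact ⟨q, rfl⟩)

/-- The unfolded domain of the orbit of `k₀`: `F_{k₀} = ⋃_{r ∈ R} r • F`. [folklore] -/
def orbitDomain32 : Set ℍ := ⋃ r ∈ cosetRepInv32 k₀, r • liftDomain32

/-- **`F_{k₀}` is a fundamental domain for the stabiliser `Γ_{k₀}`.** [folklore] -/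
theorem isFundamentalDomain_orbitDomain32 :
    IsFundamentalDomain (stabK32 k₀) (orbitDomain32 k₀) (volume : Measure ℍ) :=
  isFundamentalDomain_iUnion_smul isFundamentalDomain_liftDomain32 (stabK32 k₀) (cosetRepInv32 k₀)
    (cosetRepInv32_cov k₀) (cosetRepInv32_uniq k₀)

end Orbit

section OrbitIdentity

variable (D)

/-- Translating a set integral by a group element (invariance of `μ`). [folklore] -/
theorem setIntegral_smul_set32 {E : Type*} [NormedAddCommGroup E] [NormedSpace ℝ E] (r : Gamma0Plus 32)
    (g : ℍ → E) (S : Set ℍ) : ∫ x in r • S, g x = ∫ x in S, g (r • x) := by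
  have hmp := measurePreserving_smul r (volume : Measure ℍ)
  rw [← Set.image_smul, hmp.setIntegral_image_emb (measurableEmbedding_const_smul r) g S]

/-- Integrability transported along a translation. [folklore] -/
theorem integrableOn_smul_set_iff32 {E : Type*} [NormedAddCommGroup E] (r : Gamma0Plus 32) (g : ℍ → E)
    (S : Set ℍ) : IntegrableOn g (r • S) ↔ IntegrableOn (fun x ↦ g (r • x)) S := by
  have hmp := measurePreserving_smul r (volume : Measure ℍ)
  rw [← Set.image_smul]
  exact hmp.integrableOn_image (measurableEmbedding_const_smul r)

/-- The action of `Γ₀(32)⁺` on `ℍ` through `SL₂(ℤ)`. [folklore] -/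
theorem coe_inv_smul32 (γ : Gamma0Plus 32) (w : ℍ) : ((γ : SL(2, ℤ))⁻¹) • w = (γ⁻¹ : Gamma0Plus 32) • w := rfl

/-- Each term is integrable on `F`. [folklore] -/
theorem integrableOn_liftTerm32 (f : CuspForm (Gamma0 32) 2) (z : ℍ) (k : Fin 3 → ℤ) :
    IntegrableOn (liftTerm32 D f z k) liftDomain32 := by
  have hmeas : Measurable (liftTerm32 D f z k) :=
    measurable_liftTerm32 D (CuspFormClass.holo f).continuous.measurable z k
  refine ⟨hmeas.aestronglyMeasurable, ?_⟩
  rw [hasFiniteIntegral_iff_enorm]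
  exact lt_top_iff_ne_top.mpr (ENNReal.ne_top_of_tsum_ne_top (tsum_lintegral_enorm_liftTerm32_ne_top D f z) k)

/-- `∫_F ‖term_k‖` as the real part of the finite `lintegral`. [folklore] -/
theorem integral_norm_liftTerm32_eq_toReal (f : CuspForm (Gamma0 32) 2) (z : ℍ) (k : Fin 3 → ℤ) :
    ∫ w in liftDomain32, ‖liftTerm32 D f z k w‖ = (∫⁻ w in liftDomain32, ‖liftTerm32 D f z k w‖ₑ).toReal := by
  rw [integral_norm_eq_lintegral_enorm (integrableOn_liftTerm32 D f z k).aestronglyMeasurable]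

/-- The integrals of the norms of the terms are summable. [folklore] -/
theorem summable_integral_norm_liftTerm32 (f : CuspForm (Gamma0 32) 2) (z : ℍ) :
    Summable fun k : Fin 3 → ℤ ↦ ∫ w in liftDomain32, ‖liftTerm32 D f z k w‖ := by
  simp_rw [integral_norm_liftTerm32_eq_toReal]
  exact ENNReal.summable_toReal (tsum_lintegral_enorm_liftTerm32_ne_top D f z)

variable {D}

/-- **The orbit identity** at level `32`: `∑_{q ∈ Γ/Γ_{k₀}} ∫_F term(q.out • k₀) = ∫_{F_{k₀}} term(k₀)`,
with `term(k₀)` integrable on `F_{k₀}`. [cite: Shintani1975, §2, (2.9)] -/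
theorem tsum_quotient_integral_liftTerm32_eq (hD : Odd D) (f : CuspForm (Gamma0 32) 2) (z : ℍ)
    (k₀ : Fin 3 → ℤ) :
    IntegrableOn (liftTerm32 D f z k₀) (orbitDomain32 k₀) ∧
    ∑' q : Gamma0Plus 32 ⧸ stabK32 k₀, ∫ w in liftDomain32, liftTerm32 D f z (q.out • k₀) w =
      ∫ w in orbitDomain32 k₀, liftTerm32 D f z k₀ w := by
  haveI : Countable (cosetRepInv32 k₀) := Subtype.countable
  set ψ := liftTerm32 D f z k₀ with hψ
  have hterm : ∀ q : Gamma0Plus 32 ⧸ stabK32 k₀, ∀ w,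
      liftTerm32 D f z (q.out • k₀) w = ψ ((q.out)⁻¹ • w) := by
    intro q w
    rw [liftTerm32_smul D hD, coe_inv_smul32]
  have hint_piece : ∀ r : cosetRepInv32 k₀, IntegrableOn ψ ((r : Gamma0Plus 32) • liftDomain32) := by
    rintro ⟨r, q, rfl⟩
    rw [integrableOn_smul_set_iff32]
    have := integrableOn_liftTerm32 D f z (q.out • k₀)
    refine this.congr_fun (fun w _ ↦ ?_) measurableSet_liftDomain32
    exact hterm q w
  have hsum_piece : Summable fun r : cosetRepInv32 k₀ ↦ ∫ w in (r : Gamma0Plus 32) • liftDomain32, ‖ψ w‖ := by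
    have h1 : Summable fun q : Gamma0Plus 32 ⧸ stabK32 k₀ ↦
        ∫ w in liftDomain32, ‖liftTerm32 D f z (q.out • k₀) w‖ := by
      have hinj : Function.Injective fun q : Gamma0Plus 32 ⧸ stabK32 k₀ ↦ q.out • k₀ := by
        intro q q' h
        have hmem : (q'.out)⁻¹ * q.out ∈ stabK32 k₀ := by
          rw [MulAction.mem_stabilizer_iff, mul_smul (q'.out)⁻¹ q.out k₀]
          have h' : q.out • k₀ = q'.out • k₀ := h
          rw [h', inv_smul_smul]
        have := QuotientGroup.eq.mpr hmem
        rw [QuotientGroup.out_eq', QuotientGroup.out_eq'] at this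
        exact this.symm
      exact (summable_integral_norm_liftTerm32 D f z).comp_injective hinj
    refine (quotEquivCosetRepInv32 k₀).summable_iff.mp ?_
    convert h1 using 1
    funext q
    simp only [Function.comp_apply, quotEquivCosetRepInv32, Equiv.ofBijective_apply]
    rw [setIntegral_smul_set32]
    refine integral_congr_ae (Eventually.of_forall fun w ↦ ?_)
    simp only [hterm q w]
  have hint : IntegrableOn ψ (orbitDomain32 k₀) := by
    rw [orbitDomain32, biUnion_eq_iUnion]
    exact integrableOn_iUnion_of_summable_integral_norm hint_piece hsum_piece
  refine ⟨hint, ?_⟩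
  rw [orbitDomain32, setIntegral_iUnion_smul_eq_tsum isFundamentalDomain_liftDomain32 (cosetRepInv32 k₀)
    (by simpa only [orbitDomain32] using hint)]
  rw [← (quotEquivCosetRepInv32 k₀).tsum_eq]
  refine tsum_congr fun q ↦ ?_
  simp only [quotEquivCosetRepInv32, Equiv.ofBijective_apply]
  refine integral_congr_ae (Eventually.of_forall fun w ↦ ?_)
  exact hterm q w

end OrbitIdentity

/-! ### Subgroups of `Γ₀(32)⁺` acting on `ℍ`: measurability and invariance -/

section Instances

variable (H : Subgroup (Gamma0Plus 32))

/-- `instMeasurableSingletonClassSub32` (auxiliary). [folklore] -/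
instance instMeasurableSingletonClassSub32 : MeasurableSingletonClass H := ⟨fun _ ↦ MeasurableSet.of_discrete⟩

/-- The action of a subgroup of `Γ₀(32)⁺` on `ℍ` is measurable. [folklore] -/
instance instMeasurableSMulSub32 : MeasurableSMul H ℍ where
  measurable_const_smul c := (continuous_sl2z_smul (((c : Gamma0Plus 32) : SL(2, ℤ)))).measurable
  measurable_smul_const _ := measurable_of_countable _

/-- The hyperbolic measure is invariant under every subgroup of `Γ₀(32)⁺`. [folklore] -/
instance instSMulInvariantMeasureSub32 : SMulInvariantMeasure H ℍ (volume : Measure ℍ) := by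
  refine ⟨fun c s hs ↦ ?_⟩
  exact (measurePreserving_smul
    (Matrix.SpecialLinearGroup.mapGL ℝ (((c : Gamma0Plus 32) : SL(2, ℤ))) : GL (Fin 2) ℝ)
    (volume : Measure ℍ)).measure_preimage hs.nullMeasurableSet

end Instances

variable (D : ℕ) [NeZero D] in
/-- **Invariance of `term(k₀)` under the stabiliser of `k₀`.** [folklore] -/
theorem liftTerm32_stab_invariant (hD : Odd D) (f : CuspForm (Gamma0 32) 2) (z : ℍ) (k₀ : Fin 3 → ℤ)
    (γ : stabK32 k₀) (w : ℍ) : liftTerm32 D f z k₀ (γ • w) = liftTerm32 D f z k₀ w := by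
  have hfix : (γ : Gamma0Plus 32) • k₀ = k₀ := γ.2
  have h := liftTerm32_smul D hD f z (γ : Gamma0Plus 32) k₀ (γ • w)
  rw [hfix] at h
  rw [h]
  congr 1
  show ((γ : Gamma0Plus 32) : SL(2, ℤ))⁻¹ • (((γ : Gamma0Plus 32) : SL(2, ℤ)) • w) = w
  rw [inv_smul_smul]

end Unfolding

end Literature.NumberTheory.EllipticCurves.Shintani

noncomputable section

open scoped MatrixGroups ModularForm Modular Topology ENNReal Pointwise Manifold
open UpperHalfPlane hiding I
open Complex Filter MeasureTheory Set CongruenceSubgroup ModularGroup Real MulAction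
open Literature.NumberTheory.EllipticCurves.ModularForms

namespace Literature.NumberTheory.EllipticCurves.Shintani

/-! ### Null vectors: stabilisers in `Γ₀(32)⁺` -/

section NullStab

/-- **No `-`parabolic elements in `Γ₀(32)⁺`**: an element of `Γ₀(32) ∩ Γ₁(4)` cannot have trace
`-2`. [folklore] -/
theorem trace_ne_neg_two32 (γ : Gamma0Plus 32) : ((γ : SL(2, ℤ)) 0 0 : ℤ) + (γ : SL(2, ℤ)) 1 1 ≠ -2 := by
  intro htr
  obtain ⟨h0, h1⟩ := Subgroup.mem_inf.mp γ.2
  rw [Gamma1_mem] at h1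
  obtain ⟨ha, hd, _⟩ := h1
  have hc := thirtytwo_mul_cq32 γ
  have hdet := det_eq_one' (γ : SL(2, ℤ))
  have ha' : ((γ : SL(2, ℤ)) 0 0 : ℤ) % 4 = 1 := by
    have := (ZMod.intCast_eq_intCast_iff' ((γ : SL(2, ℤ)) 0 0 : ℤ) 1 4).mp (by rw [ha]; simp)
    simpa using this
  have hd' : ((γ : SL(2, ℤ)) 1 1 : ℤ) % 4 = 1 := by
    have := (ZMod.intCast_eq_intCast_iff' ((γ : SL(2, ℤ)) 1 1 : ℤ) 1 4).mp (by rw [hd]; simp)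
    simpa using this
  obtain ⟨s, hs⟩ : ∃ s : ℤ, ((γ : SL(2, ℤ)) 0 0 : ℤ) = 1 + 4 * s := ⟨((γ : SL(2, ℤ)) 0 0 : ℤ) / 4, by omega⟩
  obtain ⟨t, ht⟩ : ∃ t : ℤ, ((γ : SL(2, ℤ)) 1 1 : ℤ) = 1 + 4 * t := ⟨((γ : SL(2, ℤ)) 1 1 : ℤ) / 4, by omega⟩
  have had : ((γ : SL(2, ℤ)) 0 0 : ℤ) * (γ : SL(2, ℤ)) 1 1 = 1 + 4 * s + 4 * t + 16 * (s * t) := by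
    rw [hs, ht]; ring
  have hst : s + t = -1 := by omega
  have hbc : 32 * (((γ : SL(2, ℤ)) 0 1 : ℤ) * cq32 γ) = 16 * (s * t) - 4 := by
    have : ((γ : SL(2, ℤ)) 0 1 : ℤ) * (γ : SL(2, ℤ)) 1 0 = 4 * s + 4 * t + 16 * (s * t) := by
      linarith [hdet, had]
    rw [← hc] at this
    linarith
  generalize ((γ : SL(2, ℤ)) 0 1 : ℤ) * cq32 γ = X at hbc
  generalize s * t = Y at hbc
  omega

/-- `ι♮₃₂(k)` is null iff `k₁² = 128 k₀ k₂`. [folklore] -/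
theorem disc_latSharp32_eq_zero_iff (k : Fin 3 → ℤ) :
    disc (latSharp32 k) = 0 ↔ (k 1 : ℤ) ^ 2 = 128 * k 0 * k 2 := by
  rw [disc_latSharp32]
  constructor
  · intro h
    have : (((k 1 ^ 2 - 128 * k 0 * k 2 : ℤ)) : ℝ) = 0 := h
    have h' : (k 1 ^ 2 - 128 * k 0 * k 2 : ℤ) = 0 := by exact_mod_cast this
    linarith
  · intro h
    have h' : (k 1 ^ 2 - 128 * k 0 * k 2 : ℤ) = 0 := by linarith
    rw [h']; simp

/-- **Moving the double root to `∞`** for `L♮₃₂`: for a non-zero null `k` there are `σ ∈ SL₂(ℤ)`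
and `lam ≠ 0` with `ι♮₃₂(k) ∘ σ⁻¹ = lam Y²`. [folklore] -/
theorem exists_conj_to_yTwo32 {k : Fin 3 → ℤ} (hnull : disc (latSharp32 k) = 0) (hk : k ≠ 0) :
    ∃ (σ : SL(2, ℤ)) (lam : ℝ), lam ≠ 0 ∧
      actV ((σ⁻¹) 0 0 : ℤ) ((σ⁻¹) 0 1 : ℤ) ((σ⁻¹) 1 0 : ℤ) ((σ⁻¹) 1 1 : ℤ) (latSharp32 k) = yTwo lam := by
  rw [disc_latSharp32_eq_zero_iff] at hnull
  by_cases hk0 : k 0 = 0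
  · have hk1 : k 1 = 0 := by
      rw [hk0] at hnull; simpa using hnull
    have hk2 : k 2 ≠ 0 := by
      intro h2; apply hk; ext i; fin_cases i <;> simp [hk0, hk1, h2]
    refine ⟨1, k 2, by exact_mod_cast hk2, ?_⟩
    have h1 : ((1 : SL(2, ℤ))⁻¹) = 1 := inv_one
    rw [h1]
    simp only [Matrix.SpecialLinearGroup.coe_one, Matrix.one_apply_eq, ne_eq, one_ne_zero,
      not_false_eq_true, Matrix.one_apply_ne, zero_ne_one, Int.cast_one, Int.cast_zero]
    rw [actV_id]
    ext i; fin_cases i <;> simp [latSharp32, yTwo, hk0, hk1]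
  · have hg : 0 < Int.gcd (-k 1) (64 * k 0) := by
      rw [Int.gcd_pos_iff]; right; simpa using hk0
    obtain ⟨g, p, q, hgpos, hcop, hp, hq⟩ := Int.exists_gcd_one' hg
    have hq0 : q ≠ 0 := by
      intro h; rw [h, zero_mul] at hq; simp at hq; exact hk0 hq
    obtain ⟨u, v, huv⟩ : ∃ u v : ℤ, u * p + v * q = 1 := by
      have := Int.isCoprime_iff_gcd_eq_one.mpr hcop
      obtain ⟨u, v, h⟩ := this
      exact ⟨u, v, by linarith [h]⟩
    let σ : SL(2, ℤ) := ⟨!![u, v; -q, p], by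
      rw [Matrix.det_fin_two_of]; linarith⟩
    refine ⟨σ, (32 * k 0 : ℝ) / (q : ℝ) ^ 2, ?_, ?_⟩
    · have : (q : ℝ) ≠ 0 := by exact_mod_cast hq0
      have : (k 0 : ℝ) ≠ 0 := by exact_mod_cast hk0
      positivity
    · have h00 : ((σ⁻¹) 0 0 : ℤ) = p := by rw [Matrix.SpecialLinearGroup.SL2_inv_expl]; rfl
      have h01 : ((σ⁻¹) 0 1 : ℤ) = -v := by rw [Matrix.SpecialLinearGroup.SL2_inv_expl]; rfl
      have h10 : ((σ⁻¹) 1 0 : ℤ) = q := by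
        rw [Matrix.SpecialLinearGroup.SL2_inv_expl]
        show -(-q) = q; ring
      have h11 : ((σ⁻¹) 1 1 : ℤ) = u := by rw [Matrix.SpecialLinearGroup.SL2_inv_expl]; rfl
      rw [h00, h01, h10, h11]
      have hroot : 64 * (k 0 : ℝ) * p + (k 1 : ℝ) * q = 0 := by
        have h1 : (64 * k 0 * p + k 1 * q : ℤ) * g = 0 := by
          have e1 : p * (g : ℤ) = -k 1 := hp.symm
          have e2 : q * (g : ℤ) = 64 * k 0 := hq.symm
          linear_combination (64 * k 0) * e1 + (k 1) * e2
        have hg0 : (g : ℤ) ≠ 0 := by exact_mod_cast hgpos.ne'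
        have : (64 * k 0 * p + k 1 * q : ℤ) = 0 := by
          rcases mul_eq_zero.mp h1 with h | h
          · exact h
          · exact absurd h hg0
        exact_mod_cast this
      have hnullR : ((k 1 : ℤ) : ℝ) ^ 2 = 128 * (k 0 : ℤ) * (k 2 : ℤ) := by exact_mod_cast hnull
      have huvR : (u : ℝ) * p + v * q = 1 := by exact_mod_cast huv
      have hqR : (q : ℝ) ≠ 0 := by exact_mod_cast hq0
      have hk0R : ((k 0 : ℤ) : ℝ) ≠ 0 := by exact_mod_cast hk0
      set A : ℝ := 32 * (k 0 : ℤ) with hA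
      set B : ℝ := ((k 1 : ℤ) : ℝ) with hB
      set C : ℝ := ((k 2 : ℤ) : ℝ) with hC
      have hA0 : A ≠ 0 := by rw [hA]; positivity
      have hr : 2 * A * p + B * q = 0 := by rw [hA, hB]; linarith [hroot]
      have hd : B ^ 2 - 4 * A * C = 0 := by rw [hA, hB, hC]; linarith
      have hx : latSharp32 k = !₂[A, B, C] := by
        ext i; fin_cases i <;> simp [latSharp32, hA, hB, hC]
      rw [hx, yTwo]
      have e0 : A * (p : ℝ) ^ 2 + B * p * q + C * (q : ℝ) ^ 2 = 0 := by
        have h4 : 4 * A * (A * (p : ℝ) ^ 2 + B * p * q + C * (q : ℝ) ^ 2) =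
            (2 * A * p + B * q) ^ 2 - (B ^ 2 - 4 * A * C) * q ^ 2 := by ring
        rw [hr, hd] at h4
        have : 4 * A * (A * (p : ℝ) ^ 2 + B * p * q + C * (q : ℝ) ^ 2) = 0 := by rw [h4]; ring
        rcases mul_eq_zero.mp this with h | h
        · exact absurd (by linarith : A = 0) hA0
        · exact h
      have e1' : B * p + 2 * C * q = 0 := by
        have h2 : 2 * A * (B * p + 2 * C * q) = B * (2 * A * p + B * q) - (B ^ 2 - 4 * A * C) * q := by ring
        rw [hr, hd] at h2
        have : 2 * A * (B * p + 2 * C * q) = 0 := by rw [h2]; ring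
        rcases mul_eq_zero.mp this with h | h
        · exact absurd (by linarith : A = 0) hA0
        · exact h
      have e1 : 2 * A * p * (-v : ℝ) + B * (p * u + (-v) * q) + 2 * C * q * u = 0 := by
        have : 2 * A * p * (-v : ℝ) + B * (p * u + (-v) * q) + 2 * C * q * u =
            u * (B * p + 2 * C * q) - v * (2 * A * p + B * q) := by ring
        rw [this, e1', hr]; ring
      have e2 : A * (-v : ℝ) ^ 2 + B * (-v) * u + C * (u : ℝ) ^ 2 = A / (q : ℝ) ^ 2 := by
        have hE : 4 * A * ((q : ℝ) ^ 2 * (A * (-v : ℝ) ^ 2 + B * (-v) * u + C * (u : ℝ) ^ 2) -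
            A * (u * p + v * q) ^ 2) =
            -4 * A * u * v * q * (B * q + 2 * A * p) + u ^ 2 * (4 * A * C - B ^ 2) * q ^ 2 +
              u ^ 2 * (B * q - 2 * A * p) * (B * q + 2 * A * p) := by ring
        have hr' : B * q + 2 * A * p = 0 := by linarith
        have hd' : 4 * A * C - B ^ 2 = 0 := by linarith
        rw [hr', hd', huvR] at hE
        have : (q : ℝ) ^ 2 * (A * (-v : ℝ) ^ 2 + B * (-v) * u + C * (u : ℝ) ^ 2) - A * 1 ^ 2 = 0 := by
          have h0 : 4 * A * ((q : ℝ) ^ 2 * (A * (-v : ℝ) ^ 2 + B * (-v) * u + C * (u : ℝ) ^ 2) - A * 1 ^ 2) = 0 := by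
            rw [hE]; ring
          rcases mul_eq_zero.mp h0 with h | h
          · exact absurd (by linarith : A = 0) hA0
          · exact h
        field_simp
        linarith
      ext i
      fin_cases i
      · simp [actV]; linarith [e0]
      · simp [actV]; linarith [e1]
      · simp [actV]; linarith [e2]

/-- `ι♮₃₂(γ • k) = actM γ⁻¹ (ι♮₃₂ k)`. [folklore] -/
theorem latSharp32_smul_eq_actM (γ : Gamma0Plus 32) (k : Fin 3 → ℤ) :
    latSharp32 (γ • k) = actM ((γ : SL(2, ℤ))⁻¹) (latSharp32 k) := by
  obtain ⟨h00, h01, h10, h11⟩ := inv_apply (γ : SL(2, ℤ))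
  rw [latSharp32_smul, actM, h00, h01, h10, h11]

variable {k : Fin 3 → ℤ}

/-- **The stabiliser condition transported by `σ`** (`L♮₃₂`). [folklore] -/
theorem smul_eq_iff_conj32 {σ : SL(2, ℤ)} {lam : ℝ} (hlam : lam ≠ 0)
    (hσ : actM σ⁻¹ (latSharp32 k) = yTwo lam) (γ : Gamma0Plus 32) :
    γ • k = k ↔ ((σ * (γ : SL(2, ℤ)) * σ⁻¹) 1 0 : ℤ) = 0 ∧
      ((σ * (γ : SL(2, ℤ)) * σ⁻¹) 1 1 : ℤ) ^ 2 = 1 := by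
  set x := latSharp32 k with hxdef
  set τ : SL(2, ℤ) := σ * (γ : SL(2, ℤ)) * σ⁻¹ with hτ
  have hx : actM σ (yTwo lam) = x := by rw [← hσ, actM_actM, inv_mul_cancel, actM_one]
  have key : γ • k = k ↔ actM τ⁻¹ (yTwo lam) = yTwo lam := by
    constructor
    · intro h
      have h1 : actM ((γ : SL(2, ℤ))⁻¹) x = x := by rw [← latSharp32_smul_eq_actM, h]
      calc actM τ⁻¹ (yTwo lam) = actM τ⁻¹ (actM σ⁻¹ x) := by rw [hσ]
        _ = actM (σ⁻¹ * τ⁻¹) x := actM_actM _ _ _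
        _ = actM ((γ : SL(2, ℤ))⁻¹ * σ⁻¹) x := by rw [hτ]; congr 1; group
        _ = actM σ⁻¹ (actM (γ : SL(2, ℤ))⁻¹ x) := (actM_actM _ _ _).symm
        _ = actM σ⁻¹ x := by rw [h1]
        _ = yTwo lam := hσ
    · intro h
      have h1 : actM ((γ : SL(2, ℤ))⁻¹) x = x := by
        calc actM (γ : SL(2, ℤ))⁻¹ x = actM (γ : SL(2, ℤ))⁻¹ (actM σ (yTwo lam)) := by rw [hx]
          _ = actM (σ * (γ : SL(2, ℤ))⁻¹) (yTwo lam) := actM_actM _ _ _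
          _ = actM (τ⁻¹ * σ) (yTwo lam) := by rw [hτ]; congr 1; group
          _ = actM σ (actM τ⁻¹ (yTwo lam)) := (actM_actM _ _ _).symm
          _ = actM σ (yTwo lam) := by rw [h]
          _ = x := hx
      apply latSharp32_injective
      rw [latSharp32_smul_eq_actM, h1]
  rw [key, actM, yTwo, actV_Y2_eq_iff hlam]
  obtain ⟨i00, i01, i10, i11⟩ := inv_apply τ
  rw [i10, i11]
  have hdet := det_eq_one' τ
  constructor
  · rintro ⟨hc, hd⟩
    push_cast at hc
    have hc' : (τ 1 0 : ℤ) = 0 := by exact_mod_cast neg_eq_zero.mp hc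
    have ha : (τ 0 0 : ℤ) ^ 2 = 1 := by exact_mod_cast hd
    rw [hc', mul_zero, sub_zero] at hdet
    refine ⟨hc', ?_⟩
    have : ((τ 1 1 : ℤ)) ^ 2 - 1 = (τ 1 1 : ℤ) ^ 2 * (1 - (τ 0 0 : ℤ) ^ 2) := by nlinarith [hdet]
    nlinarith [this, ha]
  · rintro ⟨hc, hd⟩
    rw [hc, mul_zero, sub_zero] at hdet
    refine ⟨by rw [hc]; simp, ?_⟩
    have : (τ 0 0 : ℤ) ^ 2 = 1 := by
      have : ((τ 0 0 : ℤ)) ^ 2 - 1 = (τ 0 0 : ℤ) ^ 2 * (1 - (τ 1 1 : ℤ) ^ 2) := by nlinarith [hdet]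
      nlinarith [this, hd]
    exact_mod_cast this

/-- **Stabiliser elements are conjugate translations** (`Γ₀(32)⁺`). [folklore] -/
theorem smul_eq_iff_exists_T_zpow32 {σ : SL(2, ℤ)} {lam : ℝ} (hlam : lam ≠ 0)
    (hσ : actM σ⁻¹ (latSharp32 k) = yTwo lam) (γ : Gamma0Plus 32) :
    γ • k = k ↔ ∃ j : ℤ, σ * (γ : SL(2, ℤ)) * σ⁻¹ = ModularGroup.T ^ j := by
  rw [smul_eq_iff_conj32 hlam hσ]
  set τ : SL(2, ℤ) := σ * (γ : SL(2, ℤ)) * σ⁻¹ with hτ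
  constructor
  · rintro ⟨hc, hd2⟩
    have hd : (τ 1 1 : ℤ) = 1 ∨ (τ 1 1 : ℤ) = -1 := by
      have : ((τ 1 1 : ℤ) - 1) * ((τ 1 1 : ℤ) + 1) = 0 := by ring_nf; linarith [hd2]
      rcases mul_eq_zero.mp this with h | h
      · left; linarith
      · right; linarith
    rcases hd with hd | hd
    · exact ⟨τ 0 1, eq_T_zpow_of_c_eq_zero hc hd⟩
    · exfalso
      have hdet := det_eq_one' τ
      rw [hc, hd] at hdet
      have ha : (τ 0 0 : ℤ) = -1 := by linarith
      have htr : (τ 0 0 : ℤ) + τ 1 1 = -2 := by rw [ha, hd]; norm_num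
      have hconj := trace_conj σ (γ : SL(2, ℤ))
      rw [← hτ] at hconj
      exact trace_ne_neg_two32 γ (by linarith)
  · rintro ⟨j, hj⟩
    rw [hj, ModularGroup.coe_T_zpow]
    simp

/-- The additive subgroup `J(σ) = {j : σ⁻¹ T^j σ ∈ Γ₀(32)⁺}` of `ℤ`. [folklore] -/
def jSubgroup32 (σ : SL(2, ℤ)) : AddSubgroup ℤ where
  carrier := {j | σ⁻¹ * ModularGroup.T ^ j * σ ∈ Gamma0Plus 32}
  zero_mem' := by
    show σ⁻¹ * ModularGroup.T ^ (0 : ℤ) * σ ∈ Gamma0Plus 32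
    rw [zpow_zero, mul_one, inv_mul_cancel]
    exact (Gamma0Plus 32).one_mem
  add_mem' := by
    intro a b ha hb
    simp only [Set.mem_setOf_eq] at ha hb ⊢
    have : σ⁻¹ * ModularGroup.T ^ (a + b) * σ = (σ⁻¹ * ModularGroup.T ^ a * σ) * (σ⁻¹ * ModularGroup.T ^ b * σ) := by
      rw [_root_.zpow_add]; group
    rw [this]
    exact (Gamma0Plus 32).mul_mem ha hb
  neg_mem' := by
    intro a ha
    simp only [Set.mem_setOf_eq] at ha ⊢
    have : σ⁻¹ * ModularGroup.T ^ (-a) * σ = (σ⁻¹ * ModularGroup.T ^ a * σ)⁻¹ := by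
      rw [_root_.zpow_neg]; group
    rw [this]
    exact (Gamma0Plus 32).inv_mem ha

/-- Membership in `J(σ)`. [folklore] -/
theorem mem_jSubgroup32 {σ : SL(2, ℤ)} {j : ℤ} :
    j ∈ jSubgroup32 σ ↔ σ⁻¹ * ModularGroup.T ^ j * σ ∈ Gamma0Plus 32 := Iff.rfl

/-- `J(σ)` contains a positive integer (`Γ₀(32)⁺` has finite index in `SL₂(ℤ)`). [folklore] -/
theorem exists_pos_mem_jSubgroup32 (σ : SL(2, ℤ)) : ∃ n : ℤ, 0 < n ∧ n ∈ jSubgroup32 σ := by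
  have hidx : (Gamma0Plus 32).index ≠ 0 := Subgroup.FiniteIndex.index_ne_zero
  have hpow : ∀ n : ℕ, σ⁻¹ * ModularGroup.T ^ (n : ℤ) * σ = (σ⁻¹ * ModularGroup.T * σ) ^ n := by
    intro n
    induction n with
    | zero => simp
    | succ m ih =>
      rw [pow_succ, ← ih, Nat.cast_succ, _root_.zpow_add_one]; group
  obtain ⟨n, hn, -, hmem⟩ := Subgroup.exists_pow_mem_of_index_ne_zero hidx (σ⁻¹ * ModularGroup.T * σ)
  refine ⟨n, by exact_mod_cast hn, ?_⟩
  rw [mem_jSubgroup32, hpow n]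
  exact hmem

/-- **`J(σ) = n₀ ℤ` with `n₀ > 0`.** [folklore] -/
theorem exists_generator_jSubgroup32 (σ : SL(2, ℤ)) :
    ∃ n₀ : ℕ, 0 < n₀ ∧ ∀ j : ℤ, j ∈ jSubgroup32 σ ↔ (n₀ : ℤ) ∣ j := by
  obtain ⟨a, ha⟩ := Int.subgroup_cyclic (jSubgroup32 σ)
  obtain ⟨n, hnpos, hn⟩ := exists_pos_mem_jSubgroup32 σ
  have hmem : ∀ j : ℤ, j ∈ jSubgroup32 σ ↔ a ∣ j := by
    intro j
    rw [ha, ← AddSubgroup.zmultiples_eq_closure, Int.mem_zmultiples_iff]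
  have ha0 : a ≠ 0 := by
    intro h0
    have := (hmem n).mp hn
    rw [h0, zero_dvd_iff] at this
    omega
  refine ⟨a.natAbs, Int.natAbs_pos.mpr ha0, fun j ↦ ?_⟩
  rw [hmem, Int.natAbs_dvd]

/-- **The structure of the stabiliser of a non-zero null vector of `L♮₃₂` in `Γ₀(32)⁺`.**
[cite: Shintani1975, §2, proof of Prop. 2.3 (p. 103)] -/
theorem null_stabilizer32 (hnull : disc (latSharp32 k) = 0) (hk : k ≠ 0) :
    ∃ (σ : SL(2, ℤ)) (lam : ℝ) (n₀ : ℕ) (m : MulAction.stabilizer (Gamma0Plus 32) k → ℤ),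
      lam ≠ 0 ∧ 0 < n₀ ∧ actM σ⁻¹ (latSharp32 k) = yTwo lam ∧ Function.Bijective m ∧
      (∀ (γ : MulAction.stabilizer (Gamma0Plus 32) k) (w : ℍ),
        σ • (((γ : Gamma0Plus 32) : SL(2, ℤ)) • w) = (((n₀ : ℤ) * m γ : ℤ) : ℝ) +ᵥ (σ • w)) ∧
      σ⁻¹ * ModularGroup.T ^ (n₀ : ℤ) * σ ∈ Gamma0Plus 32 := by
  obtain ⟨σ, lam, hlam, hσ'⟩ := exists_conj_to_yTwo32 hnull hk
  have hσ : actM σ⁻¹ (latSharp32 k) = yTwo lam := hσ'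
  obtain ⟨n₀, hn₀, hJ⟩ := exists_generator_jSubgroup32 σ
  have hstab : ∀ γ : MulAction.stabilizer (Gamma0Plus 32) k,
      σ * ((γ : Gamma0Plus 32) : SL(2, ℤ)) * σ⁻¹ =
        ModularGroup.T ^ ((σ * ((γ : Gamma0Plus 32) : SL(2, ℤ)) * σ⁻¹) 0 1 : ℤ) := by
    intro γ
    have hfix : (γ : Gamma0Plus 32) • k = k := γ.2
    obtain ⟨j, hj⟩ := (smul_eq_iff_exists_T_zpow32 hlam hσ (γ : Gamma0Plus 32)).mp hfix
    rw [hj, ModularGroup.coe_T_zpow]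
    simp
  have hdvd : ∀ γ : MulAction.stabilizer (Gamma0Plus 32) k,
      (n₀ : ℤ) ∣ ((σ * ((γ : Gamma0Plus 32) : SL(2, ℤ)) * σ⁻¹) 0 1 : ℤ) := by
    intro γ
    rw [← hJ, mem_jSubgroup32, ← hstab γ]
    have : σ⁻¹ * (σ * ((γ : Gamma0Plus 32) : SL(2, ℤ)) * σ⁻¹) * σ = ((γ : Gamma0Plus 32) : SL(2, ℤ)) := by group
    rw [this]
    exact (γ : Gamma0Plus 32).2
  set m : MulAction.stabilizer (Gamma0Plus 32) k → ℤ :=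
    fun γ ↦ ((σ * ((γ : Gamma0Plus 32) : SL(2, ℤ)) * σ⁻¹) 0 1 : ℤ) / n₀ with hm
  have hmul : ∀ γ, (n₀ : ℤ) * m γ = ((σ * ((γ : Gamma0Plus 32) : SL(2, ℤ)) * σ⁻¹) 0 1 : ℤ) :=
    fun γ ↦ Int.mul_ediv_cancel' (hdvd γ)
  refine ⟨σ, lam, n₀, m, hlam, hn₀, hσ, ⟨?_, ?_⟩, ?_, (hJ n₀).mpr (dvd_refl _)⟩
  · intro γ γ' h
    have h1 : σ * ((γ : Gamma0Plus 32) : SL(2, ℤ)) * σ⁻¹ = σ * ((γ' : Gamma0Plus 32) : SL(2, ℤ)) * σ⁻¹ := by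
      rw [hstab γ, hstab γ', ← hmul γ, ← hmul γ', h]
    have h2 : ((γ : Gamma0Plus 32) : SL(2, ℤ)) = ((γ' : Gamma0Plus 32) : SL(2, ℤ)) := by
      have := congrArg (fun t ↦ σ⁻¹ * t * σ) h1
      simpa [mul_assoc] using this
    exact Subtype.ext (Subtype.ext h2)
  · intro i
    have hmemJ : (n₀ : ℤ) * i ∈ jSubgroup32 σ := (hJ _).mpr (dvd_mul_right _ _)
    rw [mem_jSubgroup32] at hmemJ
    set g : SL(2, ℤ) := σ⁻¹ * ModularGroup.T ^ ((n₀ : ℤ) * i) * σ with hg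
    have hfix : (⟨g, hmemJ⟩ : Gamma0Plus 32) • k = k := by
      rw [smul_eq_iff_exists_T_zpow32 hlam hσ]
      exact ⟨(n₀ : ℤ) * i, by rw [Subgroup.coe_mk, hg]; group⟩
    refine ⟨⟨⟨g, hmemJ⟩, hfix⟩, ?_⟩
    show ((σ * g * σ⁻¹) 0 1 : ℤ) / n₀ = i
    have : σ * g * σ⁻¹ = ModularGroup.T ^ ((n₀ : ℤ) * i) := by rw [hg]; group
    rw [this, ModularGroup.coe_T_zpow]
    simp only [Matrix.of_apply, Matrix.cons_val', Matrix.cons_val_one, Matrix.cons_val_fin_one,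
      Matrix.cons_val_zero]
    have hn0 : (n₀ : ℤ) ≠ 0 := by exact_mod_cast hn₀.ne'
    exact Int.mul_ediv_cancel_left _ hn0
  · intro γ w
    have h1 : σ • (((γ : Gamma0Plus 32) : SL(2, ℤ)) • w) = (σ * ((γ : Gamma0Plus 32) : SL(2, ℤ)) * σ⁻¹) • (σ • w) := by
      rw [← mul_smul, ← mul_smul]; congr 1; group
    rw [h1, hstab γ, ← hmul γ, UpperHalfPlane.modular_T_zpow_smul]

end NullStab

/-! ### Null orbits vanish -/

section NullOrbits

variable {D : ℕ} [NeZero D]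

/-- **The term after moving to the strip**: with `ι♮₃₂(k₀) ∘ σ⁻¹ = λ Y²`,
`term(k₀)(σ⁻¹ u) = (φ|σ⁻¹)(u) · c_D(k₀) λ e^{-4π Im Z λ²/(Im u)²}`. [folklore] -/
theorem liftTerm32_sigma_inv_smul (f : CuspForm (Gamma0 32) 2) (z : ℍ) {k₀ : Fin 3 → ℤ} {σ : SL(2, ℤ)}
    {lam : ℝ} (hσ : actM σ⁻¹ (latSharp32 k₀) = yTwo lam) (u : ℍ) :
    liftTerm32 D f z k₀ (σ⁻¹ • u) = (⇑f ∣[(2 : ℤ)] σ⁻¹) u * (cD32 D k₀ * ((lam : ℂ) *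
      cexp (((-(4 * π * (zScaled32 D z).im * lam ^ 2 / u.im ^ 2) : ℝ) : ℂ)))) := by
  set g : SL(2, ℤ) := σ⁻¹ with hg
  have hj : (((g 1 0 : ℤ) : ℂ) * u + ((g 1 1 : ℤ) : ℂ)) ≠ 0 := by
    have h := UpperHalfPlane.denom_ne_zero (g : GL (Fin 2) ℝ) u
    rw [ModularGroup.denom_apply] at h
    exact_mod_cast h
  have h1 := shintaniFn_sl_smul g u (zScaled32 D z) (latSharp32 k₀)
  have h2 : actV (g 0 0 : ℤ) (g 0 1 : ℤ) (g 1 0 : ℤ) (g 1 1 : ℤ) (latSharp32 k₀) = yTwo lam := hσ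
  rw [h2, shintaniFn_yTwo] at h1
  have h3 : (⇑f ∣[(2 : ℤ)] g) u = f (g • u) * (((g 1 0 : ℤ) : ℂ) * u + ((g 1 1 : ℤ) : ℂ)) ^ (-(2 : ℤ)) := by
    rw [ModularForm.SL_slash_apply, ModularGroup.denom_apply]
  unfold liftTerm32
  rw [h3]
  have h4 : shintaniFn (g • u) (zScaled32 D z) (latSharp32 k₀) =
      ((lam : ℂ) * cexp (((-(4 * π * (zScaled32 D z).im * lam ^ 2 / u.im ^ 2) : ℝ) : ℂ))) /
        (((g 1 0 : ℤ) : ℂ) * u + ((g 1 1 : ℤ) : ℂ)) ^ 2 := by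
    rw [eq_div_iff (pow_ne_zero 2 hj), mul_comm, ← h1]
  rw [h4, _root_.zpow_neg, zpow_ofNat]
  field_simp

/-- The translate `φ|A` of a cusp form on `Γ₀(32)` by `A ∈ SL₂(ℤ)` is holomorphic and tends to `0`
at `i∞`. [folklore] -/
theorem mdifferentiable_and_isZeroAtImInfty_slash32 (f : CuspForm (Gamma0 32) 2) (A : SL(2, ℤ)) :
    MDifferentiable 𝓘(ℂ) 𝓘(ℂ) (⇑f ∣[(2 : ℤ)] A) ∧ IsZeroAtImInfty (⇑f ∣[(2 : ℤ)] A) := by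
  haveI hA : ((ConjAct.toConjAct (A : GL (Fin 2) ℝ)⁻¹) • (Gamma0 32 : Subgroup (GL (Fin 2) ℝ))).IsArithmetic := by
    simpa [(show Rat.castHom ℝ = algebraMap ℚ ℝ by rfl), map_inv, Matrix.SpecialLinearGroup.map_mapGL]
      using! Subgroup.IsArithmetic.conj (Gamma0 32 : Subgroup (GL (Fin 2) ℝ)) (Matrix.SpecialLinearGroup.mapGL ℚ A)⁻¹
  set g := CuspForm.translate f (A : GL (Fin 2) ℝ) with hg
  have hcoe : ⇑g = (⇑f ∣[(2 : ℤ)] A) := CuspForm.coe_translate f A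
  refine ⟨?_, ?_⟩
  · rw [← hcoe]; exact CuspFormClass.holo g
  · rw [← hcoe]; exact CuspFormClass.zero_at_infty g

/-- **Periodicity of the translate**: if `σ⁻¹ T^n σ ∈ Γ₀(32)` then `(φ|σ⁻¹)(n +ᵥ u) = (φ|σ⁻¹)(u)`.
[folklore] -/
theorem slash_vadd_of_conj_T_mem32 (f : CuspForm (Gamma0 32) 2) (σ : SL(2, ℤ)) {n : ℤ}
    (hmem : σ⁻¹ * ModularGroup.T ^ n * σ ∈ Gamma0 32) (u : ℍ) :
    (⇑f ∣[(2 : ℤ)] σ⁻¹) (((n : ℝ)) +ᵥ u) = (⇑f ∣[(2 : ℤ)] σ⁻¹) u := by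
  set F : ℍ → ℂ := ⇑f ∣[(2 : ℤ)] σ⁻¹ with hF
  have hinv : F ∣[(2 : ℤ)] (ModularGroup.T ^ n) = F := by
    rw [hF, ← SlashAction.slash_mul]
    have : σ⁻¹ * ModularGroup.T ^ n = (σ⁻¹ * ModularGroup.T ^ n * σ) * σ⁻¹ := by group
    rw [this, SlashAction.slash_mul]
    congr 1
    have hmemGL : ((σ⁻¹ * ModularGroup.T ^ n * σ : SL(2, ℤ)) : GL (Fin 2) ℝ) ∈
        (Gamma0 32 : Subgroup (GL (Fin 2) ℝ)) := ⟨_, hmem, rfl⟩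
    funext w
    rw [ModularForm.slash_action_eq'_iff]
    have h := SlashInvariantForm.slash_action_eqn'' f hmemGL w
    rw [ModularGroup.denom_apply] at h
    exact h
  have h := (ModularForm.slash_action_eq'_iff (2 : ℤ) F (ModularGroup.T ^ n) u).mp (by rw [hinv])
  rw [UpperHalfPlane.modular_T_zpow_smul] at h
  rw [h, ModularGroup.coe_T_zpow]
  simp

variable (D)

/-- **The orbit of a non-zero null vector contributes `0`** (level `32`). [cite: Shintani1975, §2,
proof of Prop. 2.3 (p. 103)] -/
theorem integral_orbitDomain32_eq_zero_of_null (hD : Odd D) (f : CuspForm (Gamma0 32) 2) (z : ℍ)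
    {k₀ : Fin 3 → ℤ} (hnull : disc (latSharp32 k₀) = 0) (hk : k₀ ≠ 0) :
    ∫ w in orbitDomain32 k₀, liftTerm32 D f z k₀ w = 0 := by
  obtain ⟨σ, lam, n₀, m, hlam, hn₀, hσ, hm, hact, hTmem⟩ := null_stabilizer32 hnull hk
  have hn₀R : (0 : ℝ) < n₀ := by exact_mod_cast hn₀
  have hFD := isFundamentalDomain_orbitDomain32 k₀
  have hFD' : IsFundamentalDomain (stabK32 k₀) (σ⁻¹ • hstrip (n₀ : ℝ)) (volume : Measure ℍ) := by
    refine isFundamentalDomain_conj_hstrip σ hn₀R m hm (fun γ w ↦ ?_)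
    have h := hact γ w
    push_cast at h ⊢
    exact h
  have hinv : ∀ (γ : stabK32 k₀) (w : ℍ), liftTerm32 D f z k₀ (γ • w) = liftTerm32 D f z k₀ w :=
    liftTerm32_stab_invariant D hD f z k₀
  obtain ⟨hint, -⟩ := tsum_quotient_integral_liftTerm32_eq hD f z k₀
  rw [hFD.setIntegral_eq hFD' hinv, setIntegral_sl_smul_set]
  have hint' : IntegrableOn (fun u ↦ liftTerm32 D f z k₀ (σ⁻¹ • u)) (hstrip (n₀ : ℝ)) := by
    rw [← integrableOn_sl_smul_set_iff]
    exact (hFD.integrableOn_iff hFD' hinv).mp hint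
  simp_rw [liftTerm32_sigma_inv_smul f z hσ] at hint' ⊢
  set G : ℝ → ℂ := fun v ↦ cD32 D k₀ * ((lam : ℂ) *
    cexp (((-(4 * π * (zScaled32 D z).im * lam ^ 2 / v ^ 2) : ℝ) : ℂ))) with hG
  obtain ⟨hhol, hzero⟩ := mdifferentiable_and_isZeroAtImInfty_slash32 f σ⁻¹
  have hper : ∀ u : ℍ, (⇑f ∣[(2 : ℤ)] σ⁻¹) (((n₀ : ℝ)) +ᵥ u) = (⇑f ∣[(2 : ℤ)] σ⁻¹) u := by
    intro u
    have := slash_vadd_of_conj_T_mem32 f σ (n := (n₀ : ℤ)) (Gamma0Plus_le hTmem) u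
    exact_mod_cast this
  exact setIntegral_hstrip_mul_eq_zero (⇑f ∣[(2 : ℤ)] σ⁻¹) hhol hn₀R hper hzero G hint'

end NullOrbits

/-! ### Definite orbits vanish -/

section Definite

variable (D : ℕ) [NeZero D]

/-- **The orbit of a definite vector contributes `0`** (level `32`): trivial stabiliser, the
substitution adapted to the root, and Cauchy's theorem on the disc (`CayleyDefiniteVanishing`).
[cite: Shintani1975, §2, proof of Prop. 2.3 (p. 103)] -/
theorem integral_orbitDomain32_eq_zero_of_disc_neg (hD : Odd D) (f : CuspForm (Gamma0 32) 2) (z : ℍ)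
    {k₀ : Fin 3 → ℤ} (hneg : disc (latSharp32 k₀) < 0) :
    ∫ w in orbitDomain32 k₀, liftTerm32 D f z k₀ w = 0 := by
  haveI : Subsingleton (stabK32 k₀) := ⟨fun a b ↦ Subtype.ext
    ((eq_one_of_smul_eq_of_disc_neg32 hneg a.2).trans (eq_one_of_smul_eq_of_disc_neg32 hneg b.2).symm)⟩
  have hFD := isFundamentalDomain_orbitDomain32 k₀
  have hFD' : IsFundamentalDomain (stabK32 k₀) (univ : Set ℍ) (volume : Measure ℍ) :=
    isFundamentalDomain_univ_of_subsingleton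
  have hinv : ∀ (γ : stabK32 k₀) (w : ℍ), liftTerm32 D f z k₀ (γ • w) = liftTerm32 D f z k₀ w :=
    liftTerm32_stab_invariant D hD f z k₀
  obtain ⟨hint, -⟩ := tsum_quotient_integral_liftTerm32_eq hD f z k₀
  rw [hFD.setIntegral_eq hFD' hinv, Measure.restrict_univ]
  have hintU : Integrable (liftTerm32 D f z k₀) := by
    have := (hFD.integrableOn_iff hFD' hinv).mp hint
    rwa [integrableOn_univ] at this
  set x : V := latSharp32 k₀ with hxdef
  have hx0 : x 0 ≠ 0 := by
    intro h0
    have : disc x = x 1 ^ 2 := by rw [disc, h0]; ring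
    rw [this] at hneg
    nlinarith [sq_nonneg (x 1)]
  obtain ⟨u, v, hv, h1, h2⟩ := exists_root_of_disc_neg hx0 hneg
  rw [← integral_comp_gl_smul (gAff u v hv)]
  have hintG : Integrable fun w ↦ liftTerm32 D f z k₀ ((gAff u v hv) • w) :=
    (integrable_comp_gl_smul_iff _ _).mpr hintU
  set Z : ℍ := zScaled32 D z with hZ
  set A : ℂ := ((x 0 * v ^ 2 : ℝ) : ℂ) * cexp (2 * π * I * ((Z : ℂ).re * disc x + I * ((Z : ℂ).im * disc x))) with hA
  set G : ℝ → ℂ := fun s ↦ cexp ((-(4 * π * (Z : ℂ).im * (x 0) ^ 2 * v ^ 2 * s ^ 2) : ℝ)) with hG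
  set ψ : ℂ → ℂ := fun w ↦ f ((gAff u v hv) • UpperHalfPlane.ofComplex w) * (cD32 D k₀ * A) with hψ
  have hpt : ∀ w : ℍ, liftTerm32 D f z k₀ ((gAff u v hv) • w) =
      ψ w * (((w : ℂ)) ^ 2 + 1) * G ((Complex.normSq (w : ℂ) + 1) / w.im) := by
    intro w
    rw [liftTerm32, ← hZ, ← hxdef, shintaniFn_gAff_smul hv h1 h2 w Z, hψ, hG, hA]
    simp only [UpperHalfPlane.ofComplex_apply]
    ring
  simp_rw [hpt] at hintG ⊢
  rw [← setIntegral_univ, FdCoord.setIntegral_eq_setIntegral_image _ MeasurableSet.univ, image_univ,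
    UpperHalfPlane.range_coe]
  have hintC := (FdCoord.integrableOn_image_iff
    (fun w : ℍ ↦ ψ w * (((w : ℂ)) ^ 2 + 1) * G ((Complex.normSq (w : ℂ) + 1) / w.im)) MeasurableSet.univ).mpr
    (by rwa [integrableOn_univ])
  rw [image_univ, UpperHalfPlane.range_coe] at hintC
  have hshape : ∀ w ∈ {z : ℂ | 0 < z.im},
      ((1 / w.im ^ 2 : ℝ) : ℂ) * (ψ (UpperHalfPlane.ofComplex w) * ((((UpperHalfPlane.ofComplex w : ℍ) : ℂ)) ^ 2 + 1) *
        G ((Complex.normSq ((UpperHalfPlane.ofComplex w : ℍ) : ℂ) + 1) / (UpperHalfPlane.ofComplex w).im)) =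
      ((1 / w.im ^ 2 : ℝ) : ℂ) * (ψ w * (w ^ 2 + 1) * G ((Complex.normSq w + 1) / w.im)) := by
    intro w hw
    have hw' : 0 < w.im := hw
    rw [UpperHalfPlane.ofComplex_apply_of_im_pos hw']
    rfl
  rw [setIntegral_congr_fun (isOpen_lt continuous_const Complex.continuous_im).measurableSet hshape]
  have hintC' : IntegrableOn (fun w : ℂ ↦ ((1 / w.im ^ 2 : ℝ) : ℂ) * (ψ w * (w ^ 2 + 1) *
      G ((Complex.normSq w + 1) / w.im))) {z : ℂ | 0 < z.im} :=
    hintC.congr_fun hshape (isOpen_lt continuous_const Complex.continuous_im).measurableSet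
  have hψdiff : DifferentiableOn ℂ ψ {z : ℂ | 0 < z.im} := by
    have hf : DifferentiableOn ℂ (⇑f ∘ UpperHalfPlane.ofComplex) {z : ℂ | 0 < z.im} :=
      UpperHalfPlane.mdifferentiable_iff.mp (CuspFormClass.holo f)
    have haff : DifferentiableOn ℂ (fun w : ℂ ↦ (v : ℂ) * w + u) {z : ℂ | 0 < z.im} := by fun_prop
    have hmaps : MapsTo (fun w : ℂ ↦ (v : ℂ) * w + u) {z : ℂ | 0 < z.im} {z : ℂ | 0 < z.im} := by
      intro w hw
      show 0 < ((v : ℂ) * w + u).im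
      simpa using mul_pos hv hw
    have hcomp := hf.comp haff hmaps
    refine ((hcomp.mul_const (cD32 D k₀ * A)).congr fun w hw ↦ ?_)
    simp only [hψ, Function.comp_apply]
    rw [gAff_smul_ofComplex hv hw]
  refine setIntegral_uhp_definite_eq_zero hψdiff G ?_
  have hball := (integrableOn_uhp_iff_integrableOn_ball _).mp hintC'
  set H : ℝ → ℂ := fun r ↦ -8 * G (2 * (1 + r ^ 2) / (1 - r ^ 2)) / (((1 - r ^ 2) ^ 2 : ℝ) : ℂ) / I with hH
  set Ψ : ℂ → ℂ := fun ζ ↦ ψ (cayInv ζ) * (2 * I / (1 - ζ) ^ 2) with hΨ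
  have hball' : IntegrableOn (fun ζ ↦ H ‖ζ‖ * (ζ * Ψ ζ)) (Metric.ball (0 : ℂ) 1) := by
    refine hball.congr_fun (fun ζ hζ ↦ ?_) Metric.isOpen_ball.measurableSet
    rw [hH, hΨ]
    exact disc_integrand_eq ψ G hζ
  have hGc : Continuous G := by rw [hG]; fun_prop
  have hψc : ContinuousOn ψ {z : ℂ | 0 < z.im} := hψdiff.continuousOn
  have hcay : ContinuousOn cayInv (Metric.ball (0 : ℂ) 1) := by
    intro ζ hζ
    exact (hasDerivAt_cayInv (one_sub_ne_zero_of_mem_ball hζ)).continuousAt.continuousWithinAt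
  have hcont : ContinuousOn (fun ζ ↦ H ‖ζ‖ * (ζ * Ψ ζ)) (Metric.ball (0 : ℂ) 1) := by
    refine ContinuousOn.mul ?_ (continuousOn_id.mul ?_)
    · rw [hH]
      refine ContinuousOn.div_const ?_ _
      refine ContinuousOn.div ?_ ?_ (fun ζ hζ ↦ ?_)
      · refine continuousOn_const.mul (hGc.comp_continuousOn ?_)
        refine ContinuousOn.div (by fun_prop) (by fun_prop) (fun ζ hζ ↦ ?_)
        rw [Metric.mem_ball, dist_zero_right] at hζ
        nlinarith [norm_nonneg ζ]
      · fun_prop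
      · rw [Metric.mem_ball, dist_zero_right] at hζ
        have : (1 : ℝ) - ‖ζ‖ ^ 2 ≠ 0 := by nlinarith [norm_nonneg ζ]
        exact_mod_cast pow_ne_zero 2 this
    · rw [hΨ]
      refine ContinuousOn.mul (hψc.comp hcay (fun ζ hζ ↦ cayInv_im_pos hζ)) ?_
      refine ContinuousOn.div continuousOn_const (by fun_prop) (fun ζ hζ ↦ ?_)
      exact pow_ne_zero 2 (one_sub_ne_zero_of_mem_ball hζ)
  have hpol := integrableOn_polar_of_continuousOn hcont hball'
  refine hpol.congr_fun (fun p hp ↦ ?_) (measurableSet_Ioo.prod measurableSet_Ioo)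
  have hr : 0 < p.1 := (mem_prod.mp hp).1.1
  have hn : ‖circleMap 0 p.1 p.2‖ = p.1 := by
    rw [circleMap_zero, norm_mul, Complex.norm_real, Complex.norm_exp_ofReal_mul_I, mul_one,
      Real.norm_of_nonneg hr.le]
  simp only [hn, hH, hΨ]

end Definite

/-! ### The unfolded lift -/

section Unfolded

variable (D : ℕ) [NeZero D]

/-- The zero vector contributes nothing: `term(0) = 0`. [folklore] -/
theorem liftTerm32_zero_vec (φ : ℍ → ℂ) (z w : ℍ) : liftTerm32 D φ z 0 w = 0 := by
  have h0 : latSharp32 0 = 0 := by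
    ext i; fin_cases i <;> simp [latSharp32]
  have hf : formEval (0 : V) (w : ℂ) = 0 := by simp [formEval]
  simp [liftTerm32, h0, shintaniFn, hf]

/-- **The orbit integral of `ω`** (level `32`): `J(ω) = ∫_{F_{ω}} term(k_ω)`, `k_ω = ω.out`. [folklore] -/
def orbitIntegral32 (φ : ℍ → ℂ) (z : ℍ) (ω : orbitRel.Quotient (Gamma0Plus 32) (Fin 3 → ℤ)) : ℂ :=
  ∫ w in orbitDomain32 ω.out, liftTerm32 D φ z ω.out w

/-- **Non-indefinite orbits contribute `0`** (`D` odd, `φ ∈ S₂(Γ₀(32))`). [cite: Shintani1975, §2,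
proof of Prop. 2.3] -/
theorem orbitIntegral32_eq_zero_of_disc_nonpos (hD : Odd D) (f : CuspForm (Gamma0 32) 2) (z : ℍ)
    (ω : orbitRel.Quotient (Gamma0Plus 32) (Fin 3 → ℤ)) (hω : disc (latSharp32 ω.out) ≤ 0) :
    orbitIntegral32 D f z ω = 0 := by
  unfold orbitIntegral32
  rcases lt_or_eq_of_le hω with hneg | hnull
  · exact integral_orbitDomain32_eq_zero_of_disc_neg D hD f z hneg
  · by_cases hk : ω.out = 0
    · rw [hk]
      simp_rw [liftTerm32_zero_vec]
      exact integral_zero _ _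
    · exact integral_orbitDomain32_eq_zero_of_null D hD f z hnull hk

/-- **The unfolded lift at level `32`**: for `D` odd and `φ ∈ S₂(Γ₀(32))`,
`Φ₃₂,D(z) = √(Im z) ∑_{ω ∈ ℤ³/Γ₀(32)⁺, disc ι♮₃₂(k_ω) > 0} J(ω)`. [cite: Shintani1975, §2, (2.14)] -/
theorem shintaniLift32_eq_tsum_orbitIntegral32 (hD : Odd D) (f : CuspForm (Gamma0 32) 2) (z : ℍ) :
    shintaniLift32 D f z = (Real.sqrt z.im : ℂ) *
      ∑' ω : orbitRel.Quotient (Gamma0Plus 32) (Fin 3 → ℤ),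
        (if 0 < disc (latSharp32 ω.out) then orbitIntegral32 D f z ω else 0) := by
  rw [shintaniLift32_eq_tsum_integral D f z]
  congr 1
  have hsum : Summable fun k : Fin 3 → ℤ ↦ ∫ w in liftDomain32, liftTerm32 D f z k w :=
    (summable_norm_integral_liftTerm32 D f z).of_norm
  rw [tsum_eq_tsum_orbits_quotient (G := Gamma0Plus 32) hsum]
  refine tsum_congr fun ω ↦ ?_
  rw [(tsum_quotient_integral_liftTerm32_eq hD f z ω.out).2]
  split_ifs with h
  · rfl
  · exact orbitIntegral32_eq_zero_of_disc_nonpos D hD f z ω (not_lt.mp h)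

end Unfolded

end Literature.NumberTheory.EllipticCurves.Shintani
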